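import Mathlib.Algebra.Tropical.Basic
import Mathlib.Algebra.Order.Ring.WithTop
import Mathlib.Algebra.Order.Monoid.Unbundled.WithTop
import Mathlib.Algebra.Ring.Subsemiring.Basic
import Mathlib.Algebra.GroupWithZero.Defs
import Mathlib.Data.Real.Basic
import Mathlib.Data.Nat.Choose.Sum
import Mathlib.Algebra.BigOperators.Ring.Finset
import Literature.NumberTheory.ConnesConsani.FrobeniusCorrespondence
import HarnessLib

/-!
# Connes–Consani, *Geometry of the arithmetic site* (2016), §7: reduced correspondences and the
# composition law `Ψ(λ) ∘ Ψ(λ') = Ψ(λλ')` of the Frobenius correspondences (Theorem 7.7 = Thm. 1.2)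
# — Definition 7.1, Proposition 7.3 and the generic and rational cases of Theorem 7.7, PROVED

Topic `Literature/NumberTheory/ConnesConsani`. Source: A. Connes, C. Consani, *Geometry of the
arithmetic site*, Adv. Math. 291 (2016) 274–329 = arXiv:1502.05580 [bib
`ConnesConsani2016ArithmeticSite`], §7 "Composition of Frobenius correspondences" (Adv. Math.
numbering: Def. 7.1, Lemma 7.2, Prop. 7.3, Prop. 7.4, Lemma 7.5, Def. 7.6, Thm. 7.7, Lemma 7.8);
announced as C. R. Math. 352 (2014) 971–975 = arXiv:1405.4527 [bib `ConnesConsani2014ArithmeticSite`],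
§4.1–4.2 and Thm. 4.1. Continues `FrobeniusCorrespondence.lean` (Prop. 6.13: `ℱ(λ)`, `ℛ(λ)` and the
rigidity `ℛ(λ) ≅ ℛ(λ') ⟺ λ' ∈ {λ, 1/λ}`), the first square-level objects of the programme (HOME
CC-MAP §2.1/§2.3); with this file the second of the two theorems of the paper's introduction
(Thm. 1.1 = Thm. 3.8 is `ArithmeticSite.lean`) is typed, and proved in its generic and rational cases.

## The statements, verbatim (Adv. Math. numbering)

* **§7.1, Definition 7.1** (= CRAS §4.1): "A reduced correspondence on the arithmetic site `𝒜` is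
  given by a triple `(R, ℓ, r)`, where `R` is a semiring, `ℓ, r : ℤ_min⁺ → R` are semiring
  morphisms such that `ℓ⁻¹({0}) = {0}`, `r⁻¹({0}) = {0}` and `R` is generated by
  `ℓ(ℤ_min⁺) r(ℤ_min⁺)`." Eq. (57): "`Ψ(λ) := (R, ℓ(λ), r(λ))`, `R := ℛ(λ)`,
  `ℓ(λ) := ℱ(λ) ∘ ι₁`, `r(λ) := ℱ(λ) ∘ ι₂`"; eq. (58): "`ℓ(λ)(q^n) q^α = q^{α+nλ}`,
  `r(λ)(q^n) q^α = q^{α+n}`." Before Def. 7.1: "By construction, the semiring `ℛ(λ)` is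
  multiplicatively cancellative."
* **§7.2** (= CRAS §4.2: "The composition `Ψ(λ) ∘ Ψ(λ')` of the Frobenius correspondences is
  obtained as the left and right action of `ℕ̄` on the reduced semiring of the tensor product
  `ℛ(λ) ⊗_ℕ̄ ℛ(λ')`"): "we consider the reduced correspondence associated to the formal expression
  `(ℛ(λ) ⊗_{ℤ_min⁺} ℛ(λ'), ℓ(λ) ⊗ Id, Id ⊗ r(λ'))`. Reducing this expression means that one looks
  for the semiring associated to the semiring `ℛ(λ) ⊗_{ℤ_min⁺} ℛ(λ')` and then the sub-semiring
  generated by the images of `ℓ(λ) ⊗ Id` and `Id ⊗ r(λ')`." "we let `ℛ(λ,λ')` be the sub-semiring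
  of `ℝ₊^max` of elements of the form `q^α` for `α ∈ ℕ + λℕ + λ'ℕ`." "`Fr_u ∈ Aut(ℝ₊^max)`,
  `Fr_u(x) = x^u`".
* **Proposition 7.3.** "(i) Consider the map `ψ : ℛ(λ) × ℛ(λ') → ℛ(λλ', λ')`,
  `ψ(a,b) := Fr_{λ'}(a) b` […]. Then `ψ` is bilinear: `ψ(aa', bb') = ψ(a,b)ψ(a',b')` […] and it
  satisfies the equality `ψ(r(λ)(x)a, b) = ψ(a, ℓ(λ')(x)b)` […]. (ii) Let `R` be a semiring and
  `φ : ℛ(λ) × ℛ(λ') → R` be a bilinear map such that `φ(aa',bb') = φ(a,b)φ(a',b')` […] and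
  `φ(r(λ)(x)a, b) = φ(a, ℓ(λ')(x)b)` […]. Then, assuming `λλ' ∉ ℚλ' + ℚ`, there exists a unique
  homomorphism `ρ : ℛ(λλ',λ') → R` such that `φ = ρ ∘ ψ`." Proof of (ii): "Since `R` is
  multiplicatively cancellative, the map `R ∋ x ↦ x^n ∈ R` is an injective endomorphism" — the
  target `R` is multiplicatively cancellative throughout §7 (the "reduced" semirings of §6.5).
* **Theorem 7.7** (= Thm. 1.2 of the Introduction = CRAS 2014 Thm. 4.1). "Let `λ, λ' ∈ ℝ₊*` such
  that `λλ' ∉ ℚ`. The composition of the Frobenius correspondences is then given by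
  `Ψ(λ) ∘ Ψ(λ') = Ψ(λλ')`. The same equality holds if `λ` and `λ'` are rational. When `λ, λ'` are
  irrational and `λλ' ∈ ℚ`, `Ψ(λ) ∘ Ψ(λ') = Id_ε ∘ Ψ(λλ')` where `Id_ε` is the tangential
  deformation of the identity correspondence." Proof, first paragraph: "Let us first assume that
  `λλ' ∉ ℚλ' + ℚ`. By Proposition 7.3 the reduction of `ℛ(λ) ⊗_{ℤ_min⁺} ℛ(λ')` is `ℛ(λλ',λ')` and
  the left and right actions of `ℤ_min⁺` are given by `ℓ(q^n) q^α = q^{λλ'n} q^α`,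
  `r(q^n) q^α = q^{n+α}`. Thus the sub-semiring of the reduction […] which is generated by
  `ℓ(ℤ_min⁺)` and `r(ℤ_min⁺)` is `ℛ(λλ')` and the left and right actions of `ℤ_min⁺` are the same
  as for the correspondence `Ψ(λλ')`."

## Rendering

* Exponent coordinates as in `FrobeniusCorrespondence.lean`, but now with the zero elements kept
  and everything a Mathlib semiring: `ℝ₊^max = ([0,∞), ∨, ·)` is identified (`x = q^α`, fixed
  `q ∈ (0,1)`; `0 = q^∞`) with Mathlib's tropical semiring `𝕋 := Tropical (WithTop ℝ)` (addition
  `min`, multiplication `+` on exponents) — this identification is an isomorphism of semirings and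
  is what makes every construction "independent, up to canonical isomorphism, of the choice of
  `q ∈ (0,1)`"; `ℤ_min⁺ = ℕ̄ := Tropical (WithTop ℕ)`; `Fr_u` = exponent scaling by `u` (`frob`);
  `ℛ(λ)`, `ℛ(λ,λ')` are `Subsemiring 𝕋`'s (`frobSemiring`, `frobSemiring₂`; exponent sets
  `frobRange λ = ℕλ + ℕ` of the companion file and `frobRange₂ λ λ' = ℕλ + ℕλ' + ℕ`); `ℓ(λ)`,
  `r(λ)` are `RingHom`s `ℕ̄ →+* ℛ(λ)` (`frobEll`, `frobR`).
* Def. 7.1 is the structure `ReducedCorrespondence` over commutative semirings (all semirings of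
  the paper are commutative); "`=`" between correspondences is `ReducedCorrespondence.Iso`
  (semiring isomorphism intertwining `ℓ` and `r`). `Ψ(λ)` is `frobCorrespondence λ`.
* The composition (§7.2) is typed through the universal property by which the paper itself
  identifies "the reduced semiring of the tensor product" (Prop. 7.3 (ii), Prop. 7.4 (ii),
  Lemma 7.8 (ii); reduction = passage to the multiplicatively cancellative semiring, §6.5 and
  Prop. 6.21 (iii)): `IsTensorReduction C₁ C₂ T ψ` says that `T` is multiplicatively cancellative
  and `ψ : R₁ × R₂ → T` is a balanced bi-multiplicative bilinear map (`IsBalancedBimul`: additive and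
  zero-preserving in each variable, `ψ(aa',bb') = ψ(a,b)ψ(a',b')`, `ψ(1,1) = 1`,
  `ψ(r₁(x)a, b) = ψ(a, ℓ₂(x)b)`) which is universal among such maps into multiplicatively
  cancellative semirings ("there exists a unique homomorphism `ρ : T → R` such that
  `φ = ρ ∘ ψ`"); `IsComposition C₁ C₂ C` (= `Nonempty (CompositionDatum C₁ C₂ C)`) says that for
  such a `(T, ψ)` the semiring of `C` embeds in `T` with `ℓ ↦ ℓ₁ ⊗ Id := (x ↦ ψ(ℓ₁x, 1))` and
  `r ↦ Id ⊗ r₂ := (x ↦ ψ(1, r₂x))` — i.e. `C` is the sub-semiring generated by the images of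
  `ℓ₁ ⊗ Id` and `Id ⊗ r₂` with these as structure maps. We add `ψ(1,1) = 1` and zero-preservation
  to the paper's "bilinear" (both hold for the paper's `ψ`, and without `φ(1,1) = 1` no semiring
  homomorphism `ρ` with `φ = ρ ∘ ψ` can exist).
* What is PROVED here: the algebra of characteristic one used on p. 26 (`(x+y)^n = x^n + y^n`,
  injectivity of `x ↦ x^n` in a multiplicatively cancellative semiring with `1 + 1 = 1`:
  `add_pow_charOne`, `pow_left_injective_charOne`); Prop. 7.3 (i) (`ConnesConsani2016_prop_7_3_i`)
  and (ii) (`ConnesConsani2016_prop_7_3_ii`, via the printed addition rule (60)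
  `ConnesConsani2016_prop_7_3_addRule` with its diophantine squeeze `exists_nat_approx`), packaged
  as `ConnesConsani2016_prop_7_3 : IsTensorReduction Ψ(λ) Ψ(λ') ℛ(λλ',λ') ψ` for
  `λλ' ∉ ℚλ' + ℚ`; **Theorem 7.7 in the case `λλ' ∉ ℚλ' + ℚ`** (`ConnesConsani2016_thm_7_7_generic`,
  exactly the printed first paragraph of the proof: `ℛ(λλ') ⊂ ℛ(λλ',λ')` with the induced actions),
  hence for `λ' ∈ ℚ`, `λλ' ∉ ℚ` (`…_of_rat_right`); and **Theorem 7.7 for `λ ∈ ℚ`**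
  (`ConnesConsani2016_thm_7_7_of_rat_left`, in particular the printed "same equality holds if `λ`
  and `λ'` are rational", `ConnesConsani2016_thm_7_7_rat`) — the source states the rational case
  without proof; ours observes that for `λ = a/b` the `b`-th power of every value of `φ` is a value
  `φ(1, q^γ)` (`keyRule_of_rat`), so no diophantine approximation is needed.
* NOT typed in this file: Lemma 7.2 (factorisation through `Conv(ℕ × ℕ)`, needs §6's
  `ℤ_min ⊗_𝔹 ℤ_min`); the germ semirings `𝒢 ⊃ ℛ_ε(λλ',λ'), 𝔹_ε`, the tangential deformation
  `Id_ε` (Def. 7.6), Prop. 7.4, Lemmas 7.5/7.8 and with them the remaining cases of Thm. 7.7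
  (`λ ∉ ℚ` with `λλ' ∈ ℚλ' + ℚ`: the sub-case `λλ' ∉ ℚ` of the first sentence, and the third
  sentence `Ψ(λ) ∘ Ψ(λ') = Id_ε ∘ Ψ(λλ')`).
-/

noncomputable section

open Set Tropical

namespace Literature.NumberTheory.ConnesConsani

/-! ## `ℝ₊^max` and `ℤ_min⁺` in exponent coordinates (Mathlib tropical semirings) -/

/-- `ℝ₊^max` in exponent coordinates: `q^α ↔ trop α` (`α ∈ ℝ`), `0 ↔ trop ⊤`; the semiring
addition `∨` of `ℝ₊^max` is `min` on exponents (`q < 1`), the multiplication is `+`.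
[cite: ConnesConsani2016ArithmeticSite, §7.2 ("`ℛ(λ,λ')` […] sub-semiring of `ℝ₊^max` of elements of the form `q^α`")] -/
abbrev RMaxExp : Type := Tropical (WithTop ℝ)

/-- `ℤ_min⁺ = ℕ̄ = {q^n : n ∈ ℕ} ∪ {0}` = `(ℕ ∪ {∞}, min, +)` (CRAS 2014: "the tropical semiring
`ℕ̄`"). [cite: ConnesConsani2016ArithmeticSite, §6.1 and Def. 7.1 (`ℓ, r : ℤ_min⁺ → R`)] -/
abbrev ZMinPlus : Type := Tropical (WithTop ℕ)

local notation "𝕋" => RMaxExp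
local notation "ℕ̄" => ZMinPlus

/-- The element `q^a` of `ℝ₊^max` (`a ∈ ℝ`). [cite: ConnesConsani2016ArithmeticSite, §7.1 (notation `q^α`)] -/
def texp (a : ℝ) : 𝕋 := trop (a : WithTop ℝ)

/-- The element `q^n` of `ℤ_min⁺`. [cite: ConnesConsani2016ArithmeticSite, §7.1 (notation `q^n`)] -/
def nexp (n : ℕ) : ℕ̄ := trop (n : WithTop ℕ)

/-- Exponent of `q^a`. [cite: ConnesConsani2016ArithmeticSite, §7.1 (notation `q^α`)] -/
@[simp] theorem untrop_texp (a : ℝ) : untrop (texp a) = (a : WithTop ℝ) := rfl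
/-- Exponent of `q^n`. [cite: ConnesConsani2016ArithmeticSite, §7.1 (notation `q^n`)] -/
@[simp] theorem untrop_nexp (n : ℕ) : untrop (nexp n) = (n : WithTop ℕ) := rfl

/-- `a ↦ q^a` is injective (`q ∈ (0,1)`). [cite: ConnesConsani2016ArithmeticSite, §7.1] -/
theorem texp_injective : Function.Injective texp := fun a b h => by
  simpa [texp] using h

/-- `q^a = q^b ↔ a = b`. [cite: ConnesConsani2016ArithmeticSite, §7.1] -/
@[simp] theorem texp_inj {a b : ℝ} : texp a = texp b ↔ a = b := texp_injective.eq_iff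

/-- `q^a ≠ 0`. [cite: ConnesConsani2016ArithmeticSite, §7.1] -/
theorem texp_ne_zero (a : ℝ) : texp a ≠ 0 := by
  intro h; have := congrArg untrop h; simp at this

/-- `q^n ≠ 0` in `ℤ_min⁺`. [cite: ConnesConsani2016ArithmeticSite, §7.1] -/
theorem nexp_ne_zero (n : ℕ) : nexp n ≠ 0 := by
  intro h; have := congrArg untrop h; simp at this

/-- `q^a q^b = q^{a+b}`. [cite: ConnesConsani2016ArithmeticSite, §7.1 eq. (58)] -/
@[simp] theorem texp_mul (a b : ℝ) : texp a * texp b = texp (a + b) := by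
  apply untrop_injective; simp [untrop_mul]

/-- `q^a ∨ q^b = q^{min(a,b)}` (the addition of `ℝ₊^max`). [cite: ConnesConsani2016ArithmeticSite, Prop. 6.13 (i) (`α = inf`)] -/
@[simp] theorem texp_add (a b : ℝ) : texp a + texp b = texp (min a b) := by
  apply untrop_injective; simp [untrop_add]

/-- `q^0 = 1`. [cite: ConnesConsani2016ArithmeticSite, §7.1] -/
@[simp] theorem texp_zero : texp 0 = 1 := by
  apply untrop_injective; simp

/-- `(q^a)^n = q^{na}`. [cite: ConnesConsani2016ArithmeticSite, Prop. 7.3 (proof of (ii): `φ(q^α,q^β)^n = φ(q^{nα}, q^{nβ})`)] -/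
@[simp] theorem texp_pow (a : ℝ) (n : ℕ) : texp a ^ n = texp (n * a) := by
  apply untrop_injective; simp [untrop_pow, ← WithTop.coe_nsmul]

/-- `q^a q^b = q^{a+b}` in `ℤ_min⁺`. [cite: ConnesConsani2016ArithmeticSite, §7.1] -/
@[simp] theorem nexp_mul (a b : ℕ) : nexp a * nexp b = nexp (a + b) := by
  apply untrop_injective; simp [untrop_mul]

/-- `q^a ∨ q^b = q^{min(a,b)}` in `ℤ_min⁺`. [cite: ConnesConsani2016ArithmeticSite, §6.1 (`ℤ_min`)] -/
@[simp] theorem nexp_add (a b : ℕ) : nexp a + nexp b = nexp (min a b) := by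
  apply untrop_injective; simp only [untrop_add, untrop_nexp]; exact (WithTop.coe_min a b).symm

/-- `q^0 = 1` in `ℤ_min⁺`. [cite: ConnesConsani2016ArithmeticSite, §7.1] -/
@[simp] theorem nexp_zero : nexp 0 = 1 := by
  apply untrop_injective; simp

/-- Every element of `ℝ₊^max` is `0` or some `q^a`. [cite: ConnesConsani2016ArithmeticSite, §7.2] -/
theorem eq_zero_or_eq_texp (x : 𝕋) : x = 0 ∨ ∃ a : ℝ, x = texp a := by
  induction x using Tropical.tropRec with
  | h X =>
    cases X with
    | top => exact Or.inl rfl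
    | coe a => exact Or.inr ⟨a, rfl⟩

/-- Every element of `ℤ_min⁺` is `0` or some `q^n`. [cite: ConnesConsani2016ArithmeticSite, §6.1 (`ℤ_min⁺`)] -/
theorem eq_zero_or_eq_nexp (x : ℕ̄) : x = 0 ∨ ∃ n : ℕ, x = nexp n := by
  induction x using Tropical.tropRec with
  | h X =>
    cases X with
    | top => exact Or.inl rfl
    | coe a => exact Or.inr ⟨a, rfl⟩

/-- A non-zero element has a finite exponent. [cite: ConnesConsani2016ArithmeticSite, §7.2] -/
theorem untrop_ne_top_of_ne_zero {a : 𝕋} (ha : a ≠ 0) : untrop a ≠ ⊤ := fun h0 =>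
  ha (untrop_injective (by simpa using h0))

/-- `𝕋 = ℝ₊^max` is multiplicatively cancellative ("the semifield `ℝ₊^max` is multiplicatively
cancellative"). [cite: ConnesConsani2016ArithmeticSite, Prop. 6.21 (proof of (i))] -/
instance : IsCancelMulZero 𝕋 where
  mul_left_cancel_of_ne_zero := by
    intro a ha b c h
    apply untrop_injective
    have h' : untrop (a * b) = untrop (a * c) := congrArg untrop h
    simp only [untrop_mul] at h'
    exact (WithTop.add_left_inj (untrop_ne_top_of_ne_zero ha)).1 h'
  mul_right_cancel_of_ne_zero := by
    intro b hb a c h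
    apply untrop_injective
    have h' : untrop (a * b) = untrop (c * b) := congrArg untrop h
    simp only [untrop_mul] at h'
    exact (WithTop.add_right_inj (untrop_ne_top_of_ne_zero hb)).1 h'

/-! ## Frobenius automorphisms `Fr_u` of `ℝ₊^max` and the morphisms `q^n ↦ q^{nc}` -/

/-- The map underlying `Fr_u`: `q^a ↦ q^{ua}`, `0 ↦ 0`. [cite: ConnesConsani2016ArithmeticSite, §7.2 (`Fr_u(x) = x^u`)] -/
def frobFun (u : ℝ) (x : 𝕋) : 𝕋 := trop ((untrop x).map fun a : ℝ => u * a)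

/-- `Fr_u(q^a) = q^{ua}`. [cite: ConnesConsani2016ArithmeticSite, §7.2 (`Fr_u(x) = x^u`)] -/
@[simp] theorem frobFun_texp (u a : ℝ) : frobFun u (texp a) = texp (u * a) := rfl
/-- `Fr_u(0) = 0`. [cite: ConnesConsani2016ArithmeticSite, §7.2] -/
@[simp] theorem frobFun_zero (u : ℝ) : frobFun u 0 = 0 := rfl

/-- **`Fr_u ∈ Aut(ℝ₊^max)`, `Fr_u(x) = x^u`** (§7.2, "We denote as above `Fr_u ∈ Aut(ℝ₊^max)`,
`Fr_u(x) = x^u`"), in exponent coordinates `α ↦ uα` (`u ≥ 0`; an automorphism for `u > 0`).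
[cite: ConnesConsani2016ArithmeticSite, §7.2 (before Prop. 7.3)] -/
def frob (u : ℝ) (hu : 0 ≤ u) : 𝕋 →+* 𝕋 where
  toFun := frobFun u
  map_zero' := rfl
  map_one' := by rw [← texp_zero, frobFun_texp, mul_zero]
  map_mul' x y := by
    rcases eq_zero_or_eq_texp x with rfl | ⟨a, rfl⟩ <;>
      rcases eq_zero_or_eq_texp y with rfl | ⟨b, rfl⟩
    · simp
    · simp
    · simp
    · rw [texp_mul, frobFun_texp, frobFun_texp, frobFun_texp, texp_mul, mul_add]
  map_add' x y := by
    rcases eq_zero_or_eq_texp x with rfl | ⟨a, rfl⟩ <;>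
      rcases eq_zero_or_eq_texp y with rfl | ⟨b, rfl⟩
    · simp
    · simp
    · simp
    · rw [texp_add, frobFun_texp, frobFun_texp, frobFun_texp, texp_add]
      congr 1
      rcases le_total a b with h | h
      · rw [min_eq_left h, min_eq_left (mul_le_mul_of_nonneg_left h hu)]
      · rw [min_eq_right h, min_eq_right (mul_le_mul_of_nonneg_left h hu)]

/-- `Fr_u(q^a) = q^{ua}`. [cite: ConnesConsani2016ArithmeticSite, §7.2 (`Fr_u(x) = x^u`)] -/
@[simp] theorem frob_texp (u : ℝ) (hu : 0 ≤ u) (a : ℝ) : frob u hu (texp a) = texp (u * a) := rfl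

/-- `Fr_u(0) = 0`. [cite: ConnesConsani2016ArithmeticSite, §7.2] -/
@[simp] theorem frob_zero' (u : ℝ) (hu : 0 ≤ u) : frob u hu 0 = 0 := rfl

/-- The map underlying `q^n ↦ q^{nc}`. [cite: ConnesConsani2016ArithmeticSite, §7.1 eq. (58)] -/
def powFun (c : ℝ) (x : ℕ̄) : 𝕋 := trop ((untrop x).map fun n : ℕ => (n : ℝ) * c)

/-- `q^n ↦ q^{nc}`. [cite: ConnesConsani2016ArithmeticSite, §7.1 eq. (58)] -/
@[simp] theorem powFun_nexp (c : ℝ) (n : ℕ) : powFun c (nexp n) = texp (n * c) := rfl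
/-- `0 ↦ 0`. [cite: ConnesConsani2016ArithmeticSite, §7.1 (`ℓ⁻¹({0}) = {0}`)] -/
@[simp] theorem powFun_zero (c : ℝ) : powFun c 0 = 0 := rfl

/-- The semiring morphism `ℤ_min⁺ → ℝ₊^max`, `q^n ↦ q^{nc}` (`c ≥ 0`): for `c = λ` this is
`ℓ(λ)` and for `c = 1` it is `r(λ)` of eq. (58), viewed in the ambient `ℝ₊^max`.
[cite: ConnesConsani2016ArithmeticSite, §7.1 eq. (58)] -/
def powHom (c : ℝ) (hc : 0 ≤ c) : ℕ̄ →+* 𝕋 where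
  toFun := powFun c
  map_zero' := rfl
  map_one' := by rw [← nexp_zero, powFun_nexp, Nat.cast_zero, zero_mul, texp_zero]
  map_mul' x y := by
    rcases eq_zero_or_eq_nexp x with rfl | ⟨a, rfl⟩ <;>
      rcases eq_zero_or_eq_nexp y with rfl | ⟨b, rfl⟩
    · simp
    · simp
    · simp
    · rw [nexp_mul, powFun_nexp, powFun_nexp, powFun_nexp, texp_mul, Nat.cast_add, add_mul]
  map_add' x y := by
    rcases eq_zero_or_eq_nexp x with rfl | ⟨a, rfl⟩ <;>
      rcases eq_zero_or_eq_nexp y with rfl | ⟨b, rfl⟩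
    · simp
    · simp
    · simp
    · rw [nexp_add, powFun_nexp, powFun_nexp, powFun_nexp, texp_add]
      congr 1
      rcases le_total a b with h | h
      · rw [min_eq_left h, min_eq_left (mul_le_mul_of_nonneg_right (Nat.cast_le.2 h) hc)]
      · rw [min_eq_right h, min_eq_right (mul_le_mul_of_nonneg_right (Nat.cast_le.2 h) hc)]

/-- `q^n ↦ q^{nc}`. [cite: ConnesConsani2016ArithmeticSite, §7.1 eq. (58)] -/
@[simp] theorem powHom_nexp (c : ℝ) (hc : 0 ≤ c) (n : ℕ) :
    powHom c hc (nexp n) = texp (n * c) := rfl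

/-- `0 ↦ 0`. [cite: ConnesConsani2016ArithmeticSite, §7.1] -/
@[simp] theorem powHom_zero' (c : ℝ) (hc : 0 ≤ c) : powHom c hc 0 = 0 := rfl

/-- The kernel condition of Def. 7.1 for `q^n ↦ q^{nc}`: only `0 ↦ 0`. [cite: ConnesConsani2016ArithmeticSite, Def. 7.1 (`ℓ⁻¹({0}) = {0}, r⁻¹({0}) = {0}`)] -/
theorem powHom_eq_zero_iff {c : ℝ} (hc : 0 ≤ c) (x : ℕ̄) : powHom c hc x = 0 ↔ x = 0 := by
  rcases eq_zero_or_eq_nexp x with rfl | ⟨n, rfl⟩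
  · simp
  · simp only [powHom_nexp, texp_ne_zero, nexp_ne_zero]

/-! ## Sub-semirings of `ℝ₊^max` given by their exponent sets; `ℛ(λ)` and `ℛ(λ, λ')` -/

/-- The sub-semiring `{0} ∪ {q^a : a ∈ S}` of `ℝ₊^max` cut out by a set of exponents `S ∋ 0`
closed under `+` and `min` (the shape of `ℛ(λ)` and `ℛ(λ,λ')`). [cite: ConnesConsani2016ArithmeticSite, §7.2 (definition of `ℛ(λ,λ')`)] -/
def expSub (S : Set ℝ) (h0 : (0 : ℝ) ∈ S) (hadd : ∀ a ∈ S, ∀ b ∈ S, a + b ∈ S)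
    (hmin : ∀ a ∈ S, ∀ b ∈ S, min a b ∈ S) : Subsemiring 𝕋 where
  carrier := {x | x = 0 ∨ ∃ a ∈ S, x = texp a}
  mul_mem' := by
    rintro x y (rfl | ⟨a, ha, rfl⟩) (rfl | ⟨b, hb, rfl⟩)
    · exact Or.inl (zero_mul _)
    · exact Or.inl (zero_mul _)
    · exact Or.inl (mul_zero _)
    · exact Or.inr ⟨a + b, hadd a ha b hb, texp_mul a b⟩
  one_mem' := Or.inr ⟨0, h0, texp_zero.symm⟩
  add_mem' := by
    rintro x y (rfl | ⟨a, ha, rfl⟩) (rfl | ⟨b, hb, rfl⟩)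
    · exact Or.inl (zero_add _)
    · exact Or.inr ⟨b, hb, zero_add _⟩
    · exact Or.inr ⟨a, ha, add_zero _⟩
    · exact Or.inr ⟨min a b, hmin a ha b hb, texp_add a b⟩
  zero_mem' := Or.inl rfl

/-- Membership in an exponent-cut sub-semiring. [cite: ConnesConsani2016ArithmeticSite, §7.2 (definition of `ℛ(λ,λ')`)] -/
theorem mem_expSub_iff {S : Set ℝ} {h0 hadd hmin} {x : 𝕋} :
    x ∈ expSub S h0 hadd hmin ↔ x = 0 ∨ ∃ a ∈ S, x = texp a := Iff.rfl

/-- `q^a` lies in the sub-semiring cut out by `S` iff `a ∈ S`. [cite: ConnesConsani2016ArithmeticSite, §7.2 (definition of `ℛ(λ,λ')`)] -/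
theorem texp_mem_expSub_iff {S : Set ℝ} {h0 hadd hmin} {a : ℝ} :
    texp a ∈ expSub S h0 hadd hmin ↔ a ∈ S := by
  rw [mem_expSub_iff]
  constructor
  · rintro (h | ⟨b, hb, h⟩)
    · exact absurd h (texp_ne_zero a)
    · rwa [texp_injective h]
  · exact fun h => Or.inr ⟨a, h, rfl⟩

/-- **`ℛ(λ)` as a sub-semiring of `ℝ₊^max`**: "`ℛ(λ) := ℱ(λ,q)(ℤ_min⁺ ⊗_𝔹 ℤ_min⁺)`", "the
elements of `ℛ(λ)` are powers `q^α`, where `α ∈ ℕ + λℕ`" (together with `0`); exponent set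
`frobRange λ` of `FrobeniusCorrespondence.lean`. [cite: ConnesConsani2016ArithmeticSite, Prop. 6.13 (ii), §7.1] -/
def frobSemiring (l : ℝ) : Subsemiring 𝕋 :=
  expSub (frobRange l) (zero_mem_frobRange l) (fun _ ha _ hb => add_mem_frobRange ha hb)
    fun _ ha _ hb => min_mem_frobRange ha hb

/-- `q^a ∈ ℛ(λ) ↔ a ∈ ℕλ + ℕ`. [cite: ConnesConsani2016ArithmeticSite, §7.1 ("the elements of `ℛ(λ)` are powers `q^α`, where `α ∈ ℕ + λℕ`")] -/
theorem texp_mem_frobSemiring_iff {l a : ℝ} : texp a ∈ frobSemiring l ↔ a ∈ frobRange l :=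
  texp_mem_expSub_iff

/-- `q^{nλ+m} ∈ ℛ(λ)`. [cite: ConnesConsani2016ArithmeticSite, §7.1] -/
theorem texp_mem_frobSemiring (l : ℝ) (n m : ℕ) : texp (n * l + m) ∈ frobSemiring l :=
  texp_mem_frobSemiring_iff.2 (mem_frobRange l n m)

/-- The exponent set `ℕ + λℕ + λ'ℕ` of `ℛ(λ, λ')`. [cite: ConnesConsani2016ArithmeticSite, §7.2 (before Prop. 7.3)] -/
def frobRange₂ (l l' : ℝ) : Set ℝ :=
  {α | ∃ n m k : ℕ, α = n * l + m * l' + k}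

/-- `nλ + mλ' + k ∈ ℕλ + ℕλ' + ℕ`. [cite: ConnesConsani2016ArithmeticSite, §7.2 (definition of `ℛ(λ,λ')`)] -/
theorem mem_frobRange₂ (l l' : ℝ) (n m k : ℕ) : (n : ℝ) * l + m * l' + k ∈ frobRange₂ l l' :=
  ⟨n, m, k, rfl⟩

/-- `0 ∈ ℕλ + ℕλ' + ℕ`. [cite: ConnesConsani2016ArithmeticSite, §7.2] -/
theorem zero_mem_frobRange₂ (l l' : ℝ) : (0 : ℝ) ∈ frobRange₂ l l' := ⟨0, 0, 0, by simp⟩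

/-- `ℕλ + ℕλ' + ℕ` is closed under `+`. [cite: ConnesConsani2016ArithmeticSite, §7.2 (`ℛ(λ,λ')` a sub-semiring)] -/
theorem add_mem_frobRange₂ {l l' a b : ℝ} (ha : a ∈ frobRange₂ l l') (hb : b ∈ frobRange₂ l l') :
    a + b ∈ frobRange₂ l l' := by
  obtain ⟨n, m, k, rfl⟩ := ha
  obtain ⟨n', m', k', rfl⟩ := hb
  exact ⟨n + n', m + m', k + k', by push_cast; ring⟩

/-- `ℕλ + ℕλ' + ℕ` is closed under `min`. [cite: ConnesConsani2016ArithmeticSite, §7.2 (`ℛ(λ,λ')` a sub-semiring)] -/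
theorem min_mem_frobRange₂ {l l' a b : ℝ} (ha : a ∈ frobRange₂ l l') (hb : b ∈ frobRange₂ l l') :
    min a b ∈ frobRange₂ l l' := by
  rcases le_total a b with h | h
  · rwa [min_eq_left h]
  · rwa [min_eq_right h]

/-- **`ℛ(λ, λ')`**: "the sub-semiring of `ℝ₊^max` of elements of the form `q^α` for
`α ∈ ℕ + λℕ + λ'ℕ`" (with `0`). [cite: ConnesConsani2016ArithmeticSite, §7.2 (before Prop. 7.3)] -/
def frobSemiring₂ (l l' : ℝ) : Subsemiring 𝕋 :=
  expSub (frobRange₂ l l') (zero_mem_frobRange₂ l l') (fun _ ha _ hb => add_mem_frobRange₂ ha hb)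
    fun _ ha _ hb => min_mem_frobRange₂ ha hb

/-- `q^a ∈ ℛ(λ,λ') ↔ a ∈ ℕλ + ℕλ' + ℕ`. [cite: ConnesConsani2016ArithmeticSite, §7.2 (definition of `ℛ(λ,λ')`)] -/
theorem texp_mem_frobSemiring₂_iff {l l' a : ℝ} :
    texp a ∈ frobSemiring₂ l l' ↔ a ∈ frobRange₂ l l' :=
  texp_mem_expSub_iff

/-- `ℛ(λλ') ⊂ ℛ(λλ', λ')`. [cite: ConnesConsani2016ArithmeticSite, §7.4 (proof of Thm. 7.7, first case)] -/
theorem frobSemiring_le_frobSemiring₂ (l l' : ℝ) : frobSemiring (l * l') ≤ frobSemiring₂ (l * l') l' := by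
  rintro x (rfl | ⟨a, ⟨n, m, rfl⟩, rfl⟩)
  · exact Subsemiring.zero_mem _
  · exact Or.inr ⟨_, ⟨n, 0, m, by push_cast; ring⟩, rfl⟩

/-! ## Definition 7.1: reduced correspondences; `Ψ(λ)` (eq. (57)) -/

open Pointwise in
/-- **Connes–Consani 2016, Definition 7.1** (= CRAS 2014 §4.1): "A reduced correspondence on the
arithmetic site `𝒜` is given by a triple `(R, ℓ, r)`, where `R` is a semiring, `ℓ, r : ℤ_min⁺ → R`
are semiring morphisms such that `ℓ⁻¹({0}) = {0}`, `r⁻¹({0}) = {0}` and `R` is generated by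
`ℓ(ℤ_min⁺)r(ℤ_min⁺)`." Here `ℤ_min⁺ = ℕ̄` is Mathlib's `Tropical (WithTop ℕ)` and `R` is a
commutative semiring (all semirings of the paper are commutative). The text's standing
"multiplicatively cancellative" (the sentence before Def. 7.1; proof of Prop. 7.3 (ii)) is NOT
made part of the structure; it appears as a hypothesis where the paper uses it.
[cite: ConnesConsani2016ArithmeticSite, Def. 7.1] -/
structure ReducedCorrespondence : Type 1 where
  /-- the semiring `R` -/
  R : Type
  [instCommSemiring : CommSemiring R]
  /-- `ℓ : ℤ_min⁺ → R` -/
  ell : ℕ̄ →+* R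
  /-- `r : ℤ_min⁺ → R` -/
  r : ℕ̄ →+* R
  /-- `ℓ⁻¹({0}) = {0}` -/
  ell_eq_zero_iff : ∀ x, ell x = 0 ↔ x = 0
  /-- `r⁻¹({0}) = {0}` -/
  r_eq_zero_iff : ∀ x, r x = 0 ↔ x = 0
  /-- "`R` is generated by `ℓ(ℤ_min⁺) r(ℤ_min⁺)`" -/
  closure_eq_top : Subsemiring.closure (Set.range ell * Set.range r) = ⊤

attribute [instance] ReducedCorrespondence.instCommSemiring

namespace ReducedCorrespondence

/-- Isomorphism of reduced correspondences: a semiring isomorphism intertwining the two `ℓ`'s and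
the two `r`'s (the sense of the equalities `Ψ(λ) ∘ Ψ(λ') = Ψ(λλ')` of Thm. 7.7, cf. "Up to
canonical isomorphism, `ℛ(λ,λ')` is independent of the choice of `q`").
[cite: ConnesConsani2016ArithmeticSite, §7.2 and Thm. 7.7] -/
def Iso (C C' : ReducedCorrespondence) : Prop :=
  ∃ e : C.R ≃+* C'.R, (∀ x, e (C.ell x) = C'.ell x) ∧ ∀ x, e (C.r x) = C'.r x

/-- `Iso` is reflexive. [cite: ConnesConsani2016ArithmeticSite, Thm. 7.7 (equality of correspondences)] -/
theorem Iso.refl (C : ReducedCorrespondence) : C.Iso C :=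
  ⟨RingEquiv.refl _, fun _ => rfl, fun _ => rfl⟩

/-- `Iso` is symmetric. [cite: ConnesConsani2016ArithmeticSite, Thm. 7.7 (equality of correspondences)] -/
theorem Iso.symm {C C' : ReducedCorrespondence} (h : C.Iso C') : C'.Iso C := by
  obtain ⟨e, he, hr⟩ := h
  refine ⟨e.symm, fun x => ?_, fun x => ?_⟩
  · rw [← he, RingEquiv.symm_apply_apply]
  · rw [← hr, RingEquiv.symm_apply_apply]

/-- `Iso` is transitive. [cite: ConnesConsani2016ArithmeticSite, Thm. 7.7 (equality of correspondences)] -/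
theorem Iso.trans {C C' C'' : ReducedCorrespondence} (h : C.Iso C') (h' : C'.Iso C'') : C.Iso C'' := by
  obtain ⟨e, he, hr⟩ := h
  obtain ⟨e', he', hr'⟩ := h'
  exact ⟨e.trans e', fun x => by simp [he, he'], fun x => by simp [hr, hr']⟩

end ReducedCorrespondence

/-- `ℓ(λ) : ℤ_min⁺ → ℛ(λ)`, "`ℓ(λ)(q^n) q^α = q^{α + nλ}`" (eq. (58)), i.e. `q^n ↦ q^{nλ}`.
[cite: ConnesConsani2016ArithmeticSite, §7.1 eq. (57)–(58)] -/
def frobEll (l : ℝ) (hl : 0 < l) : ℕ̄ →+* frobSemiring l :=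
  (powHom l hl.le).codRestrict (frobSemiring l) fun x => by
    rcases eq_zero_or_eq_nexp x with rfl | ⟨n, rfl⟩
    · exact Subsemiring.zero_mem _
    · rw [powHom_nexp]
      simpa using texp_mem_frobSemiring l n 0

/-- `r(λ) : ℤ_min⁺ → ℛ(λ)`, "`r(λ)(q^n) q^α = q^{α + n}`" (eq. (58)), i.e. `q^n ↦ q^n`.
[cite: ConnesConsani2016ArithmeticSite, §7.1 eq. (57)–(58)] -/
def frobR (l : ℝ) : ℕ̄ →+* frobSemiring l :=
  (powHom 1 zero_le_one).codRestrict (frobSemiring l) fun x => by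
    rcases eq_zero_or_eq_nexp x with rfl | ⟨n, rfl⟩
    · exact Subsemiring.zero_mem _
    · rw [powHom_nexp]
      simpa using texp_mem_frobSemiring l 0 n

/-- `ℓ(λ)(q^n) = q^{nλ}` in `ℝ₊^max`. [cite: ConnesConsani2016ArithmeticSite, §7.1 eq. (58)] -/
@[simp] theorem coe_frobEll_nexp (l : ℝ) (hl : 0 < l) (n : ℕ) :
    (frobEll l hl (nexp n) : 𝕋) = texp (n * l) := rfl

/-- `r(λ)(q^n) = q^n` in `ℝ₊^max`. [cite: ConnesConsani2016ArithmeticSite, §7.1 eq. (58)] -/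
@[simp] theorem coe_frobR_nexp (l : ℝ) (n : ℕ) : (frobR l (nexp n) : 𝕋) = texp n := by
  show texp (n * 1) = texp n
  rw [mul_one]

/-- `ℓ(λ)(0) = 0`. [cite: ConnesConsani2016ArithmeticSite, Def. 7.1] -/
@[simp] theorem coe_frobEll_zero (l : ℝ) (hl : 0 < l) : (frobEll l hl 0 : 𝕋) = 0 := rfl
/-- `r(λ)(0) = 0`. [cite: ConnesConsani2016ArithmeticSite, Def. 7.1] -/
@[simp] theorem coe_frobR_zero (l : ℝ) : (frobR l 0 : 𝕋) = 0 := rfl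

open Pointwise in
/-- **The Frobenius correspondence `Ψ(λ)` as a reduced correspondence** (eq. (57) = CRAS 2014
eq. (4)): "`Ψ(λ) := (R, ℓ(λ), r(λ))`, `R := ℛ(λ)`, `ℓ(λ) := ℱ(λ) ∘ ι₁`, `r(λ) := ℱ(λ) ∘ ι₂`".
[cite: ConnesConsani2016ArithmeticSite, §7.1 eq. (57)] -/
abbrev frobCorrespondence (l : ℝ) (hl : 0 < l) : ReducedCorrespondence where
  R := frobSemiring l
  ell := frobEll l hl
  r := frobR l
  ell_eq_zero_iff x := by
    rw [← Subtype.coe_inj, Subsemiring.coe_zero]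
    exact powHom_eq_zero_iff hl.le x
  r_eq_zero_iff x := by
    rw [← Subtype.coe_inj, Subsemiring.coe_zero]
    exact powHom_eq_zero_iff zero_le_one x
  closure_eq_top := by
    refine eq_top_iff.2 fun x _ => ?_
    rcases x with ⟨x, hx⟩
    rcases hx with rfl | ⟨a, ⟨n, m, rfl⟩, rfl⟩
    · exact Subsemiring.zero_mem _
    · refine Subsemiring.subset_closure ⟨frobEll l hl (nexp n), ⟨_, rfl⟩, frobR l (nexp m), ⟨_, rfl⟩, ?_⟩
      apply Subtype.ext
      simp


/-! ## Semirings of characteristic one: `(x + y)^n = x^n + y^n` and injectivity of `x ↦ x^n`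

"We recall that a semiring of characteristic `1` is zero sum free" (proof of Lemma 7.2); "Since
`R` is multiplicatively cancellative, the map `R ∋ x ↦ x^n ∈ R` is an injective endomorphism"
(proof of Prop. 7.3 (ii), quoting [Golan] Prop. 4.43 in §6.5). We prove exactly these two facts
for a commutative semiring with `1 + 1 = 1` which is multiplicatively cancellative. -/

section CharOne

variable {R : Type*} [CommSemiring R]

/-- In a semiring with `1 + 1 = 1` (characteristic one) every element is additively idempotent:
"`a = a + a`". [cite: ConnesConsani2016ArithmeticSite, Lemma 7.2 (proof: "if `a + b = 0` then `a = a + a + b = a + b = 0`")] -/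
theorem add_self_of_one_add_one (h1 : (1 : R) + 1 = 1) (x : R) : x + x = x := by
  calc x + x = x * (1 + 1) := by rw [mul_add, mul_one]
    _ = x := by rw [h1, mul_one]

/-- `(n + 1 : R) = 1` when `1 + 1 = 1`. [folklore] -/
private theorem natCast_succ_eq_one (h1 : (1 : R) + 1 = 1) (n : ℕ) : ((n + 1 : ℕ) : R) = 1 := by
  induction n with
  | zero => simp
  | succ n ih => rw [Nat.cast_succ, ih, h1]

/-- `(n : R) = 1` for `n ≥ 1` when `1 + 1 = 1`. [folklore] -/
private theorem natCast_eq_one_of_pos (h1 : (1 : R) + 1 = 1) {n : ℕ} (hn : 0 < n) : (n : R) = 1 := by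
  obtain ⟨k, rfl⟩ : ∃ k, n = k + 1 := ⟨n - 1, by omega⟩
  exact natCast_succ_eq_one h1 k

/-- "a semiring of characteristic `1` is zero sum free": `x + y = 0 ⟹ x = 0`.
[cite: ConnesConsani2016ArithmeticSite, Lemma 7.2 (proof, eq. (59))] -/
theorem eq_zero_of_add_eq_zero_charOne (h1 : (1 : R) + 1 = 1) {x y : R} (h : x + y = 0) : x = 0 := by
  calc x = x + (x + y) := by rw [h, add_zero]
    _ = 0 := by rw [← add_assoc, add_self_of_one_add_one h1, h]

/-- A term is absorbed by the sum containing it: `f i + ∑_A f = ∑_A f` (`i ∈ A`). [folklore] -/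
private theorem add_sum_eq_sum_charOne (h1 : (1 : R) + 1 = 1) {ι : Type*} (A : Finset ι) (f : ι → R) {i : ι}
    (hi : i ∈ A) : f i + ∑ j ∈ A, f j = ∑ j ∈ A, f j := by
  classical
  rw [← Finset.add_sum_erase A f hi, ← add_assoc, add_self_of_one_add_one h1]

/-- If every term of a sum is absorbed by `b` then so is the sum. [folklore] -/
private theorem sum_add_eq_of_forall {ι : Type*} (A : Finset ι) (f : ι → R) (b : R)
    (h : ∀ i ∈ A, f i + b = b) : (∑ j ∈ A, f j) + b = b := by
  classical
  induction A using Finset.induction_on with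
  | empty => simp
  | insert a A ha ih =>
    rw [Finset.sum_insert ha, add_assoc, ih fun i hi => h i (Finset.mem_insert_of_mem hi),
      h a (Finset.mem_insert_self a A)]

/-- The binomial formula in characteristic one: `(x + y)^n = ∑_{k ≤ n} x^k y^{n−k}`. [folklore] -/
private theorem add_pow_eq_sum_charOne (h1 : (1 : R) + 1 = 1) (x y : R) (n : ℕ) :
    (x + y) ^ n = ∑ k ∈ Finset.range (n + 1), x ^ k * y ^ (n - k) := by
  rw [_root_.add_pow]
  refine Finset.sum_congr rfl fun k hk => ?_
  rw [natCast_eq_one_of_pos h1 (Nat.choose_pos ?_), mul_one]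
  simpa [Finset.mem_range, Nat.lt_succ_iff] using hk

/-- **`(x + y)^n = x^n + y^n`** in a multiplicatively cancellative semiring of characteristic one
(so `x ↦ x^n` is an endomorphism, [Golan] Prop. 4.43 as quoted in §6.5). Proof: with
`S = (x+y)^n = ∑ x^k y^{n−k}` and `T = x^n + y^n` one has `S·T = S·S` (`= (x+y)^{2n}`, termwise
absorption both ways), then cancel `S`. [cite: ConnesConsani2016ArithmeticSite, §6.5 (before Lemma 6.20) and Prop. 7.3 (proof of (ii))] -/
theorem add_pow_charOne [IsCancelMulZero R] (h1 : (1 : R) + 1 = 1) (x y : R) (n : ℕ) :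
    (x + y) ^ n = x ^ n + y ^ n := by
  rcases Nat.eq_zero_or_pos n with rfl | hn
  · simp [h1]
  set S := ∑ k ∈ Finset.range (n + 1), x ^ k * y ^ (n - k) with hS
  have hxy : (x + y) ^ n = S := add_pow_eq_sum_charOne h1 x y n
  have hSS : S * S = ∑ j ∈ Finset.range (2 * n + 1), x ^ j * y ^ (2 * n - j) := by
    rw [← hxy, ← pow_add, show n + n = 2 * n by ring, add_pow_eq_sum_charOne h1 x y (2 * n)]
  -- `S * T + S * S = S * S`
  have hA : (∑ i ∈ Finset.range (n + 1), x ^ i * y ^ (n - i) * x ^ n) +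
      ∑ j ∈ Finset.range (2 * n + 1), x ^ j * y ^ (2 * n - j) =
      ∑ j ∈ Finset.range (2 * n + 1), x ^ j * y ^ (2 * n - j) := by
    refine sum_add_eq_of_forall (Finset.range (n + 1)) (fun i => x ^ i * y ^ (n - i) * x ^ n) _
      fun i hi => ?_
    have hi' : i ≤ n := by simpa [Finset.mem_range, Nat.lt_succ_iff] using hi
    have : x ^ i * y ^ (n - i) * x ^ n = x ^ (i + n) * y ^ (2 * n - (i + n)) := by
      rw [show 2 * n - (i + n) = n - i by omega]; ring
    rw [this]
    exact add_sum_eq_sum_charOne h1 (Finset.range (2 * n + 1)) (fun j => x ^ j * y ^ (2 * n - j))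
      (i := i + n) (Finset.mem_range.2 (by omega))
  have hB : (∑ i ∈ Finset.range (n + 1), x ^ i * y ^ (n - i) * y ^ n) +
      ∑ j ∈ Finset.range (2 * n + 1), x ^ j * y ^ (2 * n - j) =
      ∑ j ∈ Finset.range (2 * n + 1), x ^ j * y ^ (2 * n - j) := by
    refine sum_add_eq_of_forall (Finset.range (n + 1)) (fun i => x ^ i * y ^ (n - i) * y ^ n) _
      fun j hj => ?_
    have hj' : j ≤ n := by simpa [Finset.mem_range, Nat.lt_succ_iff] using hj
    have : x ^ j * y ^ (n - j) * y ^ n = x ^ j * y ^ (2 * n - j) := by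
      rw [show 2 * n - j = (n - j) + n by omega, pow_add]; ring
    rw [this]
    exact add_sum_eq_sum_charOne h1 (Finset.range (2 * n + 1)) (fun j => x ^ j * y ^ (2 * n - j))
      (i := j) (Finset.mem_range.2 (by omega))
  have h_le : S * (x ^ n + y ^ n) + S * S = S * S := by
    rw [mul_add, hS, Finset.sum_mul, Finset.sum_mul, ← hS, hSS, add_assoc, hB, hA]
  -- `S * S + S * T = S * T`
  have h_ge : S * S + S * (x ^ n + y ^ n) = S * (x ^ n + y ^ n) := by
    rw [hSS]
    refine sum_add_eq_of_forall (Finset.range (2 * n + 1)) (fun j => x ^ j * y ^ (2 * n - j)) _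
      fun j hj => ?_
    have hj' : j ≤ 2 * n := by simpa [Finset.mem_range, Nat.lt_succ_iff] using hj
    rw [mul_add, hS, Finset.sum_mul, Finset.sum_mul]
    rcases le_or_gt j n with hjn | hjn
    · -- a term of `S * y^n`
      have : x ^ j * y ^ (2 * n - j) = x ^ j * y ^ (n - j) * y ^ n := by
        rw [show 2 * n - j = (n - j) + n by omega, pow_add]; ring
      rw [this, add_comm (∑ k ∈ Finset.range (n + 1), x ^ k * y ^ (n - k) * x ^ n), ← add_assoc,
        add_sum_eq_sum_charOne h1 (Finset.range (n + 1)) (fun k => x ^ k * y ^ (n - k) * y ^ n) (i := j)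
          (Finset.mem_range.2 (by omega))]
    · -- a term of `S * x^n`
      have : x ^ j * y ^ (2 * n - j) = x ^ (j - n) * y ^ (n - (j - n)) * x ^ n := by
        rw [show 2 * n - j = n - (j - n) by omega, mul_right_comm, ← pow_add,
          show j - n + n = j by omega]
      rw [this, ← add_assoc,
        add_sum_eq_sum_charOne h1 (Finset.range (n + 1)) (fun k => x ^ k * y ^ (n - k) * x ^ n)
          (i := j - n) (Finset.mem_range.2 (by omega))]
  have hST : S * (x ^ n + y ^ n) = S * S := by
    rw [← h_ge, add_comm, h_le]
  rw [hxy]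
  by_cases hS0 : S = 0
  · -- then `x + y = 0`, so `x = y = 0`
    have hxy0 : x + y = 0 := pow_eq_zero_iff hn.ne' |>.1 (hxy.trans hS0)
    have hx : x = 0 := eq_zero_of_add_eq_zero_charOne h1 hxy0
    have hy : y = 0 := eq_zero_of_add_eq_zero_charOne h1 ((add_comm y x).trans hxy0)
    rw [hS0, hx, hy, zero_pow hn.ne', add_zero]
  · exact (mul_left_cancel₀ hS0 hST).symm

/-- **Injectivity of `x ↦ x^n`** (`n ≠ 0`) in a multiplicatively cancellative semiring of
characteristic one: with `u = ∑_{i<n} x^i y^{n−1−i}` one has `x·u = y·u`, and `u ≠ 0` unless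
`x = y = 0`. [cite: ConnesConsani2016ArithmeticSite, Prop. 7.3 (proof of (ii): "the map x ↦ xⁿ is an injective endomorphism")] -/
theorem pow_left_injective_charOne [IsCancelMulZero R] (h1 : (1 : R) + 1 = 1) {n : ℕ} (hn : n ≠ 0)
    {x y : R} (h : x ^ n = y ^ n) : x = y := by
  obtain ⟨m, rfl⟩ : ∃ m, n = m + 1 := ⟨n - 1, by omega⟩
  set u := ∑ i ∈ Finset.range (m + 1), x ^ i * y ^ (m - i) with hu
  have hxu : x * u = y * u := by
    rw [hu, Finset.mul_sum, Finset.mul_sum, Finset.sum_range_succ, Finset.sum_range_succ']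
    have e1 : ∀ i ∈ Finset.range m, x * (x ^ i * y ^ (m - i)) = y * (x ^ (i + 1) * y ^ (m - (i + 1))) := by
      intro i hi
      have hi' : i < m := Finset.mem_range.1 hi
      rw [show m - i = (m - (i + 1)) + 1 by omega, pow_succ, pow_succ]
      ring
    rw [Finset.sum_congr rfl e1, Nat.sub_self, pow_zero, mul_one, Nat.sub_zero, pow_zero, one_mul,
      ← pow_succ', ← pow_succ', h]
  by_cases hu0 : u = 0
  · -- `u = y^m + … = … + x^m`, so `x^m = 0 = y^m`
    have hxm : x ^ m = 0 := by
      have hsplit : u = (∑ i ∈ Finset.range m, x ^ i * y ^ (m - i)) + x ^ m * y ^ (m - m) := by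
        rw [hu, Finset.sum_range_succ]
      have : x ^ m * y ^ (m - m) + ∑ i ∈ Finset.range m, x ^ i * y ^ (m - i) = 0 := by
        rw [add_comm, ← hsplit, hu0]
      simpa using eq_zero_of_add_eq_zero_charOne h1 this
    have hym : y ^ m = 0 := by
      have hsplit : u = (∑ i ∈ Finset.range m, x ^ (i + 1) * y ^ (m - (i + 1))) + x ^ 0 * y ^ (m - 0) := by
        rw [hu, Finset.sum_range_succ']
      have : x ^ 0 * y ^ (m - 0) + ∑ i ∈ Finset.range m, x ^ (i + 1) * y ^ (m - (i + 1)) = 0 := by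
        rw [add_comm, ← hsplit, hu0]
      simpa using eq_zero_of_add_eq_zero_charOne h1 this
    rcases Nat.eq_zero_or_pos m with rfl | hm
    · -- `1 = 0`: the semiring is trivial
      have h10 : (1 : R) = 0 := by simpa using hxm
      rw [← one_mul x, ← one_mul y, h10, zero_mul, zero_mul]
    · rw [pow_eq_zero_iff hm.ne' |>.1 hxm, pow_eq_zero_iff hm.ne' |>.1 hym]
  · exact mul_right_cancel₀ hu0 hxu

/-- `x + y = x ⟺ x^n + y^n = x^n` (`n ≠ 0`): "it is enough to show that for some `n ∈ ℕ` one has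
`φ(..)^n + φ(..)^n = φ(..)^n`". [cite: ConnesConsani2016ArithmeticSite, Prop. 7.3 (proof of (ii), eq. (61))] -/
theorem add_eq_left_of_pow_charOne [IsCancelMulZero R] (h1 : (1 : R) + 1 = 1) {n : ℕ} (hn : n ≠ 0)
    {x y : R} (h : x ^ n + y ^ n = x ^ n) : x + y = x :=
  pow_left_injective_charOne h1 hn ((add_pow_charOne h1 x y n).trans h)

end CharOne

/-! ## §7.2: the reduced tensor product and the composition of reduced correspondences -/

/-- The class of maps of Propositions 7.3/7.4 (ii): "Let `R` be a semiring and
`φ : ℛ(λ) × ℛ(λ') → R` be a bilinear map such that `φ(aa', bb') = φ(a,b)φ(a',b')`, `∀ a, a' ∈ ℛ(λ)`,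
`b, b' ∈ ℛ(λ')` and `φ(r(λ)(x)a, b) = φ(a, ℓ(λ')(x)b)` `∀ a ∈ ℛ(λ), b ∈ ℛ(λ'), x ∈ ℤ_min⁺`" — for
reduced correspondences `C₁ = (R₁, ℓ₁, r₁)`, `C₂ = (R₂, ℓ₂, r₂)`: `ψ : R₁ × R₂ → T` additive and
zero-preserving in each variable ("bilinear"), multiplicative and unital (`ψ(1,1) = 1`, as holds for
the paper's `ψ(a,b) = Fr_{λ'}(a)b` and is forced by `φ = ρ ∘ ψ` with `ρ` a semiring homomorphism),
and balanced: the right action `r₁` on `R₁` against the left action `ℓ₂` on `R₂`.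
[cite: ConnesConsani2016ArithmeticSite, Prop. 7.3 (i)–(ii)] -/
structure IsBalancedBimul (C₁ C₂ : ReducedCorrespondence) {T : Type*} [CommSemiring T]
    (ψ : C₁.R → C₂.R → T) : Prop where
  add_left : ∀ a a' b, ψ (a + a') b = ψ a b + ψ a' b
  add_right : ∀ a b b', ψ a (b + b') = ψ a b + ψ a b'
  zero_left : ∀ b, ψ 0 b = 0
  zero_right : ∀ a, ψ a 0 = 0
  mul : ∀ a a' b b', ψ (a * a') (b * b') = ψ a b * ψ a' b'
  one : ψ 1 1 = 1
  balanced : ∀ x a b, ψ (C₁.r x * a) b = ψ a (C₂.ell x * b)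

/-- **The reduced semiring of the tensor product** `R₁ ⊗_{ℤ_min⁺} R₂` (CRAS 2014 §4.2: "the
reduced semiring of the tensor product `ℛ(λ) ⊗_ℕ̄ ℛ(λ')`"; §7.2: "Reducing this expression means
that one looks for the semiring associated to the semiring `ℛ(λ) ⊗_{ℤ_min⁺} ℛ(λ')`", the associated
semiring being the multiplicatively cancellative one of §6.5, Prop. 6.21): `(T, ψ)` with `T`
multiplicatively cancellative, `ψ` a balanced bi-multiplicative bilinear map, UNIVERSAL for such
maps into multiplicatively cancellative semirings — "there exists a unique homomorphism `ρ : T → R`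
such that `φ = ρ ∘ ψ`" (the conclusion of Prop. 7.3 (ii) for `T = ℛ(λλ',λ')` and of Prop. 7.4 (ii)
for `T = ℛ_ε(λλ',λ')`). [cite: ConnesConsani2016ArithmeticSite, §7.2 and Prop. 7.3 (ii)] -/
def IsTensorReduction (C₁ C₂ : ReducedCorrespondence) (T : Type) [CommSemiring T]
    (ψ : C₁.R → C₂.R → T) : Prop :=
  IsCancelMulZero T ∧ IsBalancedBimul C₁ C₂ ψ ∧
    ∀ (R : Type) [CommSemiring R] [IsCancelMulZero R] (φ : C₁.R → C₂.R → R),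
      IsBalancedBimul C₁ C₂ φ → ∃! ρ : T →+* R, ∀ a b, ρ (ψ a b) = φ a b

/-- A witness that `C = (R, ℓ, r)` is the composition `C₁ ∘ C₂` (§7.2: "the reduced correspondence
associated to the formal expression `(ℛ(λ) ⊗_{ℤ_min⁺} ℛ(λ'), ℓ(λ) ⊗ Id, Id ⊗ r(λ'))`. Reducing this
expression means that one looks for the semiring associated to the semiring
`ℛ(λ) ⊗_{ℤ_min⁺} ℛ(λ')` and then the sub-semiring generated by the images of `ℓ(λ) ⊗ Id` and
`Id ⊗ r(λ')`"): a reduced tensor product `(T, ψ)` of `R₁ ⊗ R₂` and an embedding `R ↪ T` carrying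
`ℓ` to `ℓ₁ ⊗ Id = (x ↦ ψ(ℓ₁ x, 1))` and `r` to `Id ⊗ r₂ = (x ↦ ψ(1, r₂ x))`; as `R` is generated by
`ℓ(ℤ_min⁺) r(ℤ_min⁺)`, its image is the sub-semiring of `T` generated by these two images.
[cite: ConnesConsani2016ArithmeticSite, §7.2 (before Prop. 7.3)] -/
structure CompositionDatum (C₁ C₂ C : ReducedCorrespondence) : Type 1 where
  /-- the reduced semiring of `R₁ ⊗ R₂` -/
  T : Type
  [instT : CommSemiring T]
  /-- the universal balanced map `R₁ × R₂ → T` -/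
  ψ : C₁.R → C₂.R → T
  isTensorReduction : IsTensorReduction C₁ C₂ T ψ
  /-- `R ↪ T` -/
  emb : C.R →+* T
  emb_injective : Function.Injective emb
  emb_ell : ∀ x, emb (C.ell x) = ψ (C₁.ell x) 1
  emb_r : ∀ x, emb (C.r x) = ψ 1 (C₂.r x)

attribute [instance] CompositionDatum.instT

/-- **`C ≅ C₁ ∘ C₂`**: `C` is (isomorphic to) the composition of the reduced correspondences `C₁`
and `C₂` in the sense of §7.2 / CRAS 2014 §4.2. [cite: ConnesConsani2016ArithmeticSite, §7.2 (before Prop. 7.3)] -/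
def IsComposition (C₁ C₂ C : ReducedCorrespondence) : Prop :=
  Nonempty (CompositionDatum C₁ C₂ C)



open Pointwise in
/-- In a composition datum the image of `R ↪ T` is exactly "the sub-semiring generated by the
images of `ℓ₁ ⊗ Id` and `Id ⊗ r₂`" (because `R` is generated by `ℓ(ℤ_min⁺) r(ℤ_min⁺)`).
[cite: ConnesConsani2016ArithmeticSite, §7.2 (before Prop. 7.3)] -/
theorem CompositionDatum.rangeS_emb {C₁ C₂ C : ReducedCorrespondence} (D : CompositionDatum C₁ C₂ C) :
    D.emb.rangeS = Subsemiring.closure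
      (Set.range (fun x => D.ψ (C₁.ell x) 1) * Set.range (fun x => D.ψ 1 (C₂.r x))) := by
  rw [RingHom.rangeS_eq_map, ← C.closure_eq_top, RingHom.map_closureS, Set.image_mul,
    ← Set.range_comp, ← Set.range_comp]
  congr 3
  · funext x; exact D.emb_ell x
  · funext x; exact D.emb_r x

/-- `IsComposition C₁ C₂ ·` is invariant under isomorphism of the third argument. [cite: ConnesConsani2016ArithmeticSite, §7.2 ("Up to canonical isomorphism")] -/
theorem IsComposition.of_iso {C₁ C₂ C C' : ReducedCorrespondence} (h : IsComposition C₁ C₂ C)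
    (e : C'.Iso C) : IsComposition C₁ C₂ C' := by
  obtain ⟨D⟩ := h
  obtain ⟨e, he, hr⟩ := e
  exact ⟨CompositionDatum.mk D.T D.ψ D.isTensorReduction (D.emb.comp e.toRingHom)
    (D.emb_injective.comp e.injective) (fun x => by simp [he, D.emb_ell])
    (fun x => by simp [hr, D.emb_r])⟩

/-! ## Multiplicative cancellation in sub-semirings of `ℝ₊^max` -/

/-- Sub-semirings of `ℝ₊^max` are multiplicatively cancellative ("By construction, the semiring
`ℛ(λ)` is multiplicatively cancellative"). [cite: ConnesConsani2016ArithmeticSite, §7.1 (before Def. 7.1)] -/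
instance (S : Subsemiring 𝕋) : IsCancelMulZero S where
  mul_left_cancel_of_ne_zero := by
    intro a ha b c h
    apply Subtype.ext
    have h' : (a : 𝕋) * b = a * c := by simpa using congrArg Subtype.val h
    exact mul_left_cancel₀ (fun h0 => ha (Subtype.ext h0)) h'
  mul_right_cancel_of_ne_zero := by
    intro b hb a c h
    apply Subtype.ext
    have h' : (a : 𝕋) * b = c * b := by simpa using congrArg Subtype.val h
    exact mul_right_cancel₀ (fun h0 => hb (Subtype.ext h0)) h'

/-! ## Elements `q^a` of `ℛ(λ)` and the calculus of balanced bilinear multiplicative maps -/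

/-- `ℕλ + ℕ` is closed under `a ↦ na` (`(q^a)^n ∈ ℛ(λ)`). [cite: ConnesConsani2016ArithmeticSite, §7.1 (`ℛ(λ)` a semiring)] -/
theorem nat_mul_mem_frobRange' {l a : ℝ} (ha : a ∈ frobRange l) (n : ℕ) : (n : ℝ) * a ∈ frobRange l := by
  obtain ⟨x, y, rfl⟩ := ha
  exact ⟨n * x, n * y, by push_cast; ring⟩

/-- The element `q^a ∈ ℛ(λ)`, `a ∈ ℕλ + ℕ`. [cite: ConnesConsani2016ArithmeticSite, §7.1] -/
def rElt (l a : ℝ) (ha : a ∈ frobRange l) : frobSemiring l :=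
  ⟨texp a, texp_mem_frobSemiring_iff.2 ha⟩

/-- `q^a ∈ ℛ(λ)` viewed in `ℝ₊^max`. [cite: ConnesConsani2016ArithmeticSite, §7.1] -/
@[simp] theorem coe_rElt (l a : ℝ) (ha : a ∈ frobRange l) : (rElt l a ha : 𝕋) = texp a := rfl

/-- Equal exponents give equal elements. [cite: ConnesConsani2016ArithmeticSite, §7.1] -/
theorem rElt_congr {l a b : ℝ} (ha : a ∈ frobRange l) (hb : b ∈ frobRange l) (h : a = b) :
    rElt l a ha = rElt l b hb := by
  subst h; rfl

/-- `q^0 = 1` in `ℛ(λ)`. [cite: ConnesConsani2016ArithmeticSite, §7.1] -/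
theorem rElt_zero (l : ℝ) (h : (0 : ℝ) ∈ frobRange l) : rElt l 0 h = 1 :=
  Subtype.ext texp_zero

/-- `q^a ∨ q^b = q^{min(a,b)}` in `ℛ(λ)`. [cite: ConnesConsani2016ArithmeticSite, Prop. 6.13 (i)] -/
theorem rElt_add {l a b : ℝ} (ha : a ∈ frobRange l) (hb : b ∈ frobRange l) (h : min a b ∈ frobRange l) :
    rElt l a ha + rElt l b hb = rElt l (min a b) h :=
  Subtype.ext (by simp)

/-- `q^a q^b = q^{a+b}` in `ℛ(λ)`. [cite: ConnesConsani2016ArithmeticSite, §7.1 eq. (58)] -/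
theorem rElt_mul {l a b : ℝ} (ha : a ∈ frobRange l) (hb : b ∈ frobRange l) (h : a + b ∈ frobRange l) :
    rElt l a ha * rElt l b hb = rElt l (a + b) h :=
  Subtype.ext (by simp)

/-- `ℛ(λ)` has characteristic one: `1 + 1 = 1`. [cite: ConnesConsani2016ArithmeticSite, Lemma 7.2 (proof: "a semiring of characteristic 1")] -/
theorem one_add_one_frobSemiring (l : ℝ) : (1 : frobSemiring l) + 1 = 1 :=
  Subtype.ext (by simp [← texp_zero])

/-- "`r(λ)(q^n) q^α = q^{α+n}`". [cite: ConnesConsani2016ArithmeticSite, §7.1 eq. (58)] -/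
theorem frobR_nexp_mul_rElt {l a : ℝ} (ha : a ∈ frobRange l) (k : ℕ) (h : a + k ∈ frobRange l) :
    frobR l (nexp k) * rElt l a ha = rElt l (a + k) h :=
  Subtype.ext (by simp [add_comm])

/-- "`ℓ(λ)(q^n) q^α = q^{α+nλ}`". [cite: ConnesConsani2016ArithmeticSite, §7.1 eq. (58)] -/
theorem frobEll_nexp_mul_rElt {l a : ℝ} (hl : 0 < l) (ha : a ∈ frobRange l) (k : ℕ)
    (h : a + k * l ∈ frobRange l) : frobEll l hl (nexp k) * rElt l a ha = rElt l (a + k * l) h :=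
  Subtype.ext (by simp [add_comm])

/-- Every element of `ℛ(λ)` is `0` or `q^{nλ+m}`. [cite: ConnesConsani2016ArithmeticSite, §7.1 ("the elements of `ℛ(λ)` are powers `q^α`, where `α ∈ ℕ + λℕ`")] -/
theorem eq_zero_or_eq_rElt {l : ℝ} (a : frobSemiring l) :
    a = 0 ∨ ∃ n m : ℕ, a = rElt l (n * l + m) (mem_frobRange l n m) := by
  obtain ⟨a, (rfl | ⟨α, ⟨n, m, rfl⟩, rfl⟩)⟩ := a
  · exact Or.inl rfl
  · exact Or.inr ⟨n, m, rfl⟩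

section Calculus

variable {l l' : ℝ} {hl : 0 < l} {hl' : 0 < l'} {R : Type*} [CommSemiring R]
  {φ : frobSemiring l → frobSemiring l' → R}
  (hφ : IsBalancedBimul (frobCorrespondence l hl) (frobCorrespondence l' hl') φ)
include hφ

/-- Additivity in the first variable, restated on `ℛ(λ)`. [cite: ConnesConsani2016ArithmeticSite, Prop. 7.3 (ii) ("bilinear")] -/
theorem IsBalancedBimul.add_left' (a a' : frobSemiring l) (b : frobSemiring l') :
    φ (a + a') b = φ a b + φ a' b := hφ.add_left a a' b

/-- Additivity in the second variable, restated on `ℛ(λ')`. [cite: ConnesConsani2016ArithmeticSite, Prop. 7.3 (ii) ("bilinear")] -/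
theorem IsBalancedBimul.add_right' (a : frobSemiring l) (b b' : frobSemiring l') :
    φ a (b + b') = φ a b + φ a b' := hφ.add_right a b b'

/-- `φ(0, b) = 0`. [cite: ConnesConsani2016ArithmeticSite, Prop. 7.3 (ii) ("bilinear")] -/
theorem IsBalancedBimul.zero_left' (b : frobSemiring l') : φ 0 b = 0 := hφ.zero_left b

/-- `φ(a, 0) = 0`. [cite: ConnesConsani2016ArithmeticSite, Prop. 7.3 (ii) ("bilinear")] -/
theorem IsBalancedBimul.zero_right' (a : frobSemiring l) : φ a 0 = 0 := hφ.zero_right a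

/-- "`φ(aa', bb') = φ(a,b)φ(a',b')`". [cite: ConnesConsani2016ArithmeticSite, Prop. 7.3 (ii)] -/
theorem IsBalancedBimul.mul' (a a' : frobSemiring l) (b b' : frobSemiring l') :
    φ (a * a') (b * b') = φ a b * φ a' b' := hφ.mul a a' b b'

/-- `φ(1,1) = 1`. [cite: ConnesConsani2016ArithmeticSite, Prop. 7.3 (ii)] -/
theorem IsBalancedBimul.one' : φ (1 : frobSemiring l) (1 : frobSemiring l') = 1 := hφ.one

/-- "`φ(r(λ)(x)a, b) = φ(a, ℓ(λ')(x)b)`" (eq. (61)). [cite: ConnesConsani2016ArithmeticSite, Prop. 7.3 (ii) eq. (61)] -/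
theorem IsBalancedBimul.balanced' (x : ℕ̄) (a : frobSemiring l) (b : frobSemiring l') :
    φ (frobR l x * a) b = φ a (frobEll l' hl' x * b) := hφ.balanced x a b

/-- `1 + 1 = 1` in the target of a balanced bilinear multiplicative map out of `ℛ(λ) × ℛ(λ')`
(so the target is of characteristic one). [cite: ConnesConsani2016ArithmeticSite, Lemma 7.2 (proof) and Prop. 7.3 (proof of (ii))] -/
theorem IsBalancedBimul.one_add_one : (1 : R) + 1 = 1 := by
  have h := hφ.add_left' 1 1 1
  rw [one_add_one_frobSemiring, hφ.one'] at h
  exact h.symm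

/-- For `a ≤ a'`: `φ(q^a, b) + φ(q^{a'}, b) = φ(q^a, b)` (bilinearity with `q^a ∨ q^{a'} = q^a`; "using `nα₁ ≤ k` and the bilinearity of `φ`"). [cite: ConnesConsani2016ArithmeticSite, Prop. 7.3 (proof of (ii))] -/
theorem IsBalancedBimul.add_left_le {a a' : ℝ} (ha : a ∈ frobRange l) (ha' : a' ∈ frobRange l)
    (hle : a ≤ a') (b : frobSemiring l') :
    φ (rElt l a ha) b + φ (rElt l a' ha') b = φ (rElt l a ha) b := by
  rw [← hφ.add_left', rElt_add ha ha' (by rwa [min_eq_left hle])]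
  exact congrArg (fun X => φ X b) (rElt_congr _ _ (min_eq_left hle))

/-- For `b ≤ b'`: `φ(a, q^b) + φ(a, q^{b'}) = φ(a, q^b)`. [cite: ConnesConsani2016ArithmeticSite, Prop. 7.3 (proof of (ii))] -/
theorem IsBalancedBimul.add_right_le (a : frobSemiring l) {b b' : ℝ} (hb : b ∈ frobRange l')
    (hb' : b' ∈ frobRange l') (hle : b ≤ b') :
    φ a (rElt l' b hb) + φ a (rElt l' b' hb') = φ a (rElt l' b hb) := by
  rw [← hφ.add_right', rElt_add hb hb' (by rwa [min_eq_left hle])]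
  exact congrArg (fun X => φ a X) (rElt_congr _ _ (min_eq_left hle))

/-- Multiplicativity on exponents: `φ(q^{a+a'}, q^{b+b'}) = φ(q^a,q^b) φ(q^{a'},q^{b'})`. [cite: ConnesConsani2016ArithmeticSite, Prop. 7.3 (proof of (ii): "Using the multiplicativity of `φ`")] -/
theorem IsBalancedBimul.mul_rElt {a a' b b' : ℝ} (ha : a ∈ frobRange l) (ha' : a' ∈ frobRange l)
    (hb : b ∈ frobRange l') (hb' : b' ∈ frobRange l') (h : a + a' ∈ frobRange l)
    (h' : b + b' ∈ frobRange l') :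
    φ (rElt l (a + a') h) (rElt l' (b + b') h') = φ (rElt l a ha) (rElt l' b hb) * φ (rElt l a' ha') (rElt l' b' hb') := by
  rw [← rElt_mul ha ha', ← rElt_mul hb hb', hφ.mul']

/-- "`φ(q^{α_j}, q^{β_j})^n = φ(q^{nα_j}, q^{nβ_j})`". [cite: ConnesConsani2016ArithmeticSite, Prop. 7.3 (proof of (ii))] -/
theorem IsBalancedBimul.pow_rElt {a b : ℝ} (ha : a ∈ frobRange l) (hb : b ∈ frobRange l') (n : ℕ)
    (h : (n : ℝ) * a ∈ frobRange l) (h' : (n : ℝ) * b ∈ frobRange l') :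
    φ (rElt l (n * a) h) (rElt l' (n * b) h') = φ (rElt l a ha) (rElt l' b hb) ^ n := by
  induction n with
  | zero =>
    rw [pow_zero, rElt_congr h (zero_mem_frobRange l) (by simp),
      rElt_congr h' (zero_mem_frobRange l') (by simp), rElt_zero, rElt_zero, hφ.one']
  | succ n ih =>
    rw [pow_succ, ← ih (nat_mul_mem_frobRange' ha n) (nat_mul_mem_frobRange' hb n),
      ← hφ.mul_rElt (nat_mul_mem_frobRange' ha n) ha (nat_mul_mem_frobRange' hb n) hb
        (add_mem_frobRange (nat_mul_mem_frobRange' ha n) ha)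
        (add_mem_frobRange (nat_mul_mem_frobRange' hb n) hb)]
    congr 1
    · exact rElt_congr _ _ (by push_cast; ring)
    · exact rElt_congr _ _ (by push_cast; ring)

/-- "(hypo2): `φ(q^α, q^{β + λ'k}) = φ(q^{α+k}, q^β)`". [cite: ConnesConsani2016ArithmeticSite, Prop. 7.3 (proof of (ii), eq. (62))] -/
theorem IsBalancedBimul.bal_rElt {a b : ℝ} (ha : a ∈ frobRange l) (hb : b ∈ frobRange l') (k : ℕ)
    (h : a + k ∈ frobRange l) (h' : b + k * l' ∈ frobRange l') :
    φ (rElt l (a + k) h) (rElt l' b hb) = φ (rElt l a ha) (rElt l' (b + k * l') h') := by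
  rw [← frobR_nexp_mul_rElt ha k h, ← frobEll_nexp_mul_rElt hl' hb k h']
  exact hφ.balanced' (nexp k) (rElt l a ha) (rElt l' b hb)

/-- Values of `φ` are additively idempotent. [cite: ConnesConsani2016ArithmeticSite, Lemma 7.2 (proof: characteristic one)] -/
theorem IsBalancedBimul.add_self (a : frobSemiring l) (b : frobSemiring l') : φ a b + φ a b = φ a b :=
  add_self_of_one_add_one hφ.one_add_one _

end Calculus

/-! ## §7.2: `ψ(a, b) := Fr_{λ'}(a) b` and Proposition 7.3 -/

/-- `Fr_{λ'}(a) b ∈ ℛ(λλ', λ')` for `a ∈ ℛ(λ)`, `b ∈ ℛ(λ')`: "`ψ : ℛ(λ) × ℛ(λ') → ℛ(λλ',λ')`".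
[cite: ConnesConsani2016ArithmeticSite, Prop. 7.3 (i)] -/
theorem frob_mul_mem_frobSemiring₂ {l l' : ℝ} (hl' : 0 < l') (a : frobSemiring l) (b : frobSemiring l') :
    frob l' hl'.le a * b ∈ frobSemiring₂ (l * l') l' := by
  rcases eq_zero_or_eq_rElt a with rfl | ⟨n, m, rfl⟩
  · simp
  rcases eq_zero_or_eq_rElt b with rfl | ⟨n', m', rfl⟩
  · simp
  simp only [coe_rElt, frob_texp, texp_mul, texp_mem_frobSemiring₂_iff]
  exact ⟨n, m + n', m', by push_cast; ring⟩

/-- **The map `ψ` of Proposition 7.3 (i)**: "`ψ : ℛ(λ) × ℛ(λ') → ℛ(λλ', λ')`,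
`ψ(a, b) := Fr_{λ'}(a) b` `∀ a ∈ ℛ(λ), b ∈ ℛ(λ')`". [cite: ConnesConsani2016ArithmeticSite, Prop. 7.3 (i)] -/
def frobPsi (l l' : ℝ) (hl' : 0 < l') (a : frobSemiring l) (b : frobSemiring l') :
    frobSemiring₂ (l * l') l' :=
  ⟨frob l' hl'.le a * b, frob_mul_mem_frobSemiring₂ hl' a b⟩

/-- `ψ(a,b) = Fr_{λ'}(a) b` in `ℝ₊^max`. [cite: ConnesConsani2016ArithmeticSite, Prop. 7.3 (i)] -/
@[simp] theorem coe_frobPsi (l l' : ℝ) (hl' : 0 < l') (a : frobSemiring l) (b : frobSemiring l') :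
    (frobPsi l l' hl' a b : 𝕋) = frob l' hl'.le a * b := rfl

/-- `ψ(q^α, q^β) = q^{λ'α + β}` ("`ψ(q^{α+n}, q^β) = q^{λ'(α+n)+β}`"). [cite: ConnesConsani2016ArithmeticSite, Prop. 7.3 (proof of (i))] -/
theorem coe_frobPsi_rElt {l l' : ℝ} (hl' : 0 < l') {a b : ℝ} (ha : a ∈ frobRange l) (hb : b ∈ frobRange l') :
    (frobPsi l l' hl' (rElt l a ha) (rElt l' b hb) : 𝕋) = texp (l' * a + b) := by
  simp

/-- `Fr_{λ'} ∘ r(λ) = ℓ(λ')` in `ℝ₊^max`: `Fr_{λ'}(q^n) = q^{nλ'}` (the computation behind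
"`ψ(r(λ)(x)a, b) = ψ(a, ℓ(λ')(x)b)`"). [cite: ConnesConsani2016ArithmeticSite, Prop. 7.3 (proof of (i))] -/
theorem frob_frobR {l l' : ℝ} (hl' : 0 < l') (x : ℕ̄) :
    frob l' hl'.le (frobR l x : 𝕋) = (frobEll l' hl' x : 𝕋) := by
  rcases eq_zero_or_eq_nexp x with rfl | ⟨n, rfl⟩
  · simp
  · rw [coe_frobEll_nexp, coe_frobR_nexp, frob_texp, mul_comm]

/-- **Connes–Consani 2016, Proposition 7.3 (i)**: "`ψ` is bilinear: `ψ(aa', bb') = ψ(a,b)ψ(a',b')`,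
`∀ a, a' ∈ ℛ(λ)`, `b, b' ∈ ℛ(λ')` and it satisfies the equality
`ψ(r(λ)(x)a, b) = ψ(a, ℓ(λ')(x)b)` `∀ a ∈ ℛ(λ), b ∈ ℛ(λ'), x ∈ ℤ_min⁺`."
[cite: ConnesConsani2016ArithmeticSite, Prop. 7.3 (i)] -/
theorem ConnesConsani2016_prop_7_3_i {l l' : ℝ} (hl : 0 < l) (hl' : 0 < l') :
    IsBalancedBimul (frobCorrespondence l hl) (frobCorrespondence l' hl') (frobPsi l l' hl') where
  add_left a a' b := Subtype.ext (by
    show frob l' hl'.le ((a : 𝕋) + a') * b = frob l' hl'.le a * b + frob l' hl'.le a' * b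
    rw [map_add, add_mul])
  add_right a b b' := Subtype.ext (by
    show frob l' hl'.le a * ((b : 𝕋) + b') = frob l' hl'.le a * b + frob l' hl'.le a * b'
    rw [mul_add])
  zero_left b := Subtype.ext (by
    show frob l' hl'.le (0 : 𝕋) * b = 0
    rw [map_zero, zero_mul])
  zero_right a := Subtype.ext (by
    show frob l' hl'.le (a : 𝕋) * 0 = 0
    rw [mul_zero])
  mul a a' b b' := Subtype.ext (by
    show frob l' hl'.le ((a : 𝕋) * a') * (b * b') = frob l' hl'.le a * b * (frob l' hl'.le a' * b')
    rw [map_mul]; ring)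
  one := Subtype.ext (by
    show frob l' hl'.le (1 : 𝕋) * 1 = 1
    rw [map_one, mul_one])
  balanced x a b := Subtype.ext (by
    show frob l' hl'.le ((frobR l x : 𝕋) * a) * b = frob l' hl'.le a * ((frobEll l' hl' x : 𝕋) * b)
    rw [map_mul, frob_frobR hl' x]; ring)

/-! ### The universal property from the addition rule (60) -/

section Universal

variable {l l' : ℝ} (hl : 0 < l) (hl' : 0 < l') {R : Type} [CommSemiring R]
  (φ : frobSemiring l → frobSemiring l' → R)

/-- `Φ(x, β) := φ(q^{xλ}, q^β)` (the values through which `ρ` is defined: "Define the map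
`ρ : ℛ(λλ',λ') → R` by `ρ(q^z) := φ(q^{xλ}, q^β)`", `z = xλλ' + β`).
[cite: ConnesConsani2016ArithmeticSite, Prop. 7.3 (proof of (ii))] -/
def Phi (x : ℕ) (β : ℝ) (hβ : β ∈ frobRange l') : R :=
  φ (rElt l (x * l) (nat_mul_mem_frobRange l x)) (rElt l' β hβ)

/-- The addition rule behind the additivity and well-definedness of `ρ`: for `z = xλλ' + β ≤
z' = x'λλ' + β'`, `ρ(q^z) + ρ(q^{z'}) = ρ(q^z)` ("This follows from (60) applied to `α₁ = xλ`,
`β₁ = β`, `α₂ = x'λ`, `β₂ = β'`"). [cite: ConnesConsani2016ArithmeticSite, Prop. 7.3 (proof of (ii), eq. (60))] -/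
def KeyRule (φ : frobSemiring l → frobSemiring l' → R) : Prop :=
  ∀ (x : ℕ) (β : ℝ) (hβ : β ∈ frobRange l') (x' : ℕ) (β' : ℝ) (hβ' : β' ∈ frobRange l'),
    x * (l * l') + β ≤ x' * (l * l') + β' → Phi φ x β hβ + Phi φ x' β' hβ' = Phi φ x β hβ

/-- Every non-zero element of `ℛ(λλ',λ')` is `q^z`, `z = xλλ' + β`, `x ∈ ℕ`, `β ∈ ℕλ' + ℕ`. [cite: ConnesConsani2016ArithmeticSite, Prop. 7.3 (proof of (ii))] -/
theorem exists_rep (t : frobSemiring₂ (l * l') l') (ht : (t : 𝕋) ≠ 0) :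
    ∃ x : ℕ, ∃ β : ℝ, β ∈ frobRange l' ∧ (t : 𝕋) = texp (x * (l * l') + β) := by
  obtain ⟨t, (rfl | ⟨z, ⟨n, m, k, rfl⟩, rfl⟩)⟩ := t
  · exact absurd rfl ht
  · exact ⟨n, m * l' + k, mem_frobRange l' m k, by simp [add_assoc]⟩

/-- The map `ρ` on `ℛ(λλ', λ')`: `ρ(0) = 0`, `ρ(q^{xλλ'+β}) = φ(q^{xλ}, q^β)`.
[cite: ConnesConsani2016ArithmeticSite, Prop. 7.3 (proof of (ii))] -/
def rhoFun (t : frobSemiring₂ (l * l') l') : R :=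
  if ht : (t : 𝕋) = 0 then 0
  else Phi φ (exists_rep t ht).choose (exists_rep t ht).choose_spec.choose
    (exists_rep t ht).choose_spec.choose_spec.1

/-- `ρ(0) = 0`. [cite: ConnesConsani2016ArithmeticSite, Prop. 7.3 (proof of (ii))] -/
theorem rhoFun_zero : rhoFun φ 0 = 0 := by
  have h : ((0 : frobSemiring₂ (l * l') l') : 𝕋) = 0 := rfl
  unfold rhoFun
  exact dif_pos h

variable (hK : KeyRule φ)
include hK

/-- `φ(q^{xλ}, q^β)` depends only on `z = xλλ' + β` (given the addition rule). [cite: ConnesConsani2016ArithmeticSite, Prop. 7.3 (proof of (ii): "Define the map `ρ`")] -/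
theorem Phi_wd {x x' : ℕ} {β β' : ℝ} (hβ : β ∈ frobRange l') (hβ' : β' ∈ frobRange l')
    (h : x * (l * l') + β = x' * (l * l') + β') : Phi φ x β hβ = Phi φ x' β' hβ' := by
  rw [← hK x β hβ x' β' hβ' h.le, add_comm, hK x' β' hβ' x β hβ h.ge]

/-- "`ρ(q^z) := φ(q^{xλ}, q^β)`", `z = xλλ' + β`, for any such representation. [cite: ConnesConsani2016ArithmeticSite, Prop. 7.3 (proof of (ii))] -/
theorem rhoFun_rep (t : frobSemiring₂ (l * l') l') {x : ℕ} {β : ℝ} (hβ : β ∈ frobRange l')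
    (h : (t : 𝕋) = texp (x * (l * l') + β)) : rhoFun φ t = Phi φ x β hβ := by
  have ht : (t : 𝕋) ≠ 0 := by rw [h]; exact texp_ne_zero _
  unfold rhoFun
  rw [dif_neg ht]
  refine Phi_wd φ hK _ _ (texp_injective ?_)
  rw [← (exists_rep t ht).choose_spec.choose_spec.2, h]

variable (hφ : IsBalancedBimul (frobCorrespondence l hl) (frobCorrespondence l' hl') φ)
include hφ

/-- **The homomorphism `ρ : ℛ(λλ', λ') → R`** of Prop. 7.3 (ii) ("It is multiplicative by
construction. We show that it is additive"). [cite: ConnesConsani2016ArithmeticSite, Prop. 7.3 (proof of (ii))] -/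
def rhoHom : frobSemiring₂ (l * l') l' →+* R where
  toFun := rhoFun φ
  map_zero' := rhoFun_zero φ
  map_one' := by
    have h1 : ((1 : frobSemiring₂ (l * l') l') : 𝕋) = texp ((0 : ℕ) * (l * l') + 0) := by simp
    rw [rhoFun_rep φ hK 1 (zero_mem_frobRange l') h1]
    show φ _ _ = 1
    rw [rElt_congr _ (zero_mem_frobRange l) (by simp), rElt_zero, rElt_zero, hφ.one']
  map_mul' t t' := by
    by_cases ht : (t : 𝕋) = 0
    · rw [show t = 0 from Subtype.ext ht, zero_mul, rhoFun_zero, zero_mul]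
    by_cases ht' : (t' : 𝕋) = 0
    · rw [show t' = 0 from Subtype.ext ht', mul_zero, rhoFun_zero, mul_zero]
    obtain ⟨x, β, hβ, hx⟩ := exists_rep t ht
    obtain ⟨x', β', hβ', hx'⟩ := exists_rep t' ht'
    have hxx : ((t * t' : frobSemiring₂ (l * l') l') : 𝕋) = texp ((x + x' : ℕ) * (l * l') + (β + β')) := by
      rw [Subsemiring.coe_mul, hx, hx', texp_mul]; push_cast; ring_nf
    rw [rhoFun_rep φ hK t hβ hx, rhoFun_rep φ hK t' hβ' hx',
      rhoFun_rep φ hK (t * t') (add_mem_frobRange hβ hβ') hxx]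
    show φ _ _ = φ _ _ * φ _ _
    rw [← hφ.mul_rElt (nat_mul_mem_frobRange l x) (nat_mul_mem_frobRange l x') hβ hβ'
      (add_mem_frobRange (nat_mul_mem_frobRange l x) (nat_mul_mem_frobRange l x'))
      (add_mem_frobRange hβ hβ')]
    congr 1
    exact rElt_congr _ _ (by push_cast; ring)
  map_add' t t' := by
    by_cases ht : (t : 𝕋) = 0
    · rw [show t = 0 from Subtype.ext ht, zero_add, rhoFun_zero, zero_add]
    by_cases ht' : (t' : 𝕋) = 0
    · rw [show t' = 0 from Subtype.ext ht', add_zero, rhoFun_zero, add_zero]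
    obtain ⟨x, β, hβ, hx⟩ := exists_rep t ht
    obtain ⟨x', β', hβ', hx'⟩ := exists_rep t' ht'
    rw [rhoFun_rep φ hK t hβ hx, rhoFun_rep φ hK t' hβ' hx']
    rcases le_total (x * (l * l') + β) (x' * (l * l') + β') with hle | hle
    · have hs : ((t + t' : frobSemiring₂ (l * l') l') : 𝕋) = texp (x * (l * l') + β) := by
        rw [Subsemiring.coe_add, hx, hx', texp_add, min_eq_left hle]
      rw [rhoFun_rep φ hK (t + t') hβ hs, hK x β hβ x' β' hβ' hle]
    · have hs : ((t + t' : frobSemiring₂ (l * l') l') : 𝕋) = texp (x' * (l * l') + β') := by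
        rw [Subsemiring.coe_add, hx, hx', texp_add, min_eq_right hle]
      rw [rhoFun_rep φ hK (t + t') hβ' hs, add_comm, hK x' β' hβ' x β hβ hle]

/-- `ρ` as a function. [cite: ConnesConsani2016ArithmeticSite, Prop. 7.3 (proof of (ii))] -/
theorem rhoHom_apply (t : frobSemiring₂ (l * l') l') : rhoHom hl hl' φ hK hφ t = rhoFun φ t := rfl

/-- `φ = ρ ∘ ψ`. [cite: ConnesConsani2016ArithmeticSite, Prop. 7.3 (proof of (ii), last display)] -/
theorem rhoHom_frobPsi (a : frobSemiring l) (b : frobSemiring l') :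
    rhoHom hl hl' φ hK hφ (frobPsi l l' hl' a b) = φ a b := by
  rw [rhoHom_apply]
  rcases eq_zero_or_eq_rElt a with rfl | ⟨n, m, rfl⟩
  · rw [hφ.zero_left', show frobPsi l l' hl' 0 b = 0 from Subtype.ext (by simp), rhoFun_zero]
  rcases eq_zero_or_eq_rElt b with rfl | ⟨n', m', rfl⟩
  · rw [hφ.zero_right', show frobPsi l l' hl' _ 0 = 0 from Subtype.ext (by simp), rhoFun_zero]
  have hrep : ((frobPsi l l' hl' (rElt l (n * l + m) (mem_frobRange l n m))
      (rElt l' (n' * l' + m') (mem_frobRange l' n' m')) : frobSemiring₂ (l * l') l') : 𝕋) =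
      texp (n * (l * l') + ((m + n' : ℕ) * l' + m')) := by
    rw [coe_frobPsi_rElt]; push_cast; ring_nf
  rw [rhoFun_rep φ hK _ (mem_frobRange l' (m + n') m') hrep]
  show φ _ _ = φ _ _
  rw [hφ.bal_rElt (nat_mul_mem_frobRange l n) (mem_frobRange l' n' m') m (mem_frobRange l n m)
    (by simpa [add_mul, add_assoc, add_comm, add_left_comm] using mem_frobRange l' (m + n') m')]
  congr 1
  exact rElt_congr _ _ (by push_cast; ring)

/-- Prop. 7.3 (ii) / 7.3-type universal property from the addition rule: existence and uniqueness
of `ρ` with `φ = ρ ∘ ψ`. [cite: ConnesConsani2016ArithmeticSite, Prop. 7.3 (ii)] -/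
theorem existsUnique_rho :
    ∃! ρ : frobSemiring₂ (l * l') l' →+* R, ∀ a b, ρ (frobPsi l l' hl' a b) = φ a b := by
  refine ⟨rhoHom hl hl' φ hK hφ, rhoHom_frobPsi hl hl' φ hK hφ, fun ρ' hρ' => RingHom.ext fun t => ?_⟩
  by_cases ht : (t : 𝕋) = 0
  · rw [show t = 0 from Subtype.ext ht, map_zero, map_zero]
  obtain ⟨x, β, hβ, hx⟩ := exists_rep t ht
  have : t = frobPsi l l' hl' (rElt l (x * l) (nat_mul_mem_frobRange l x)) (rElt l' β hβ) :=
    Subtype.ext (by rw [hx, coe_frobPsi_rElt]; ring_nf)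
  rw [this, hρ', rhoHom_frobPsi]

end Universal

/-- From the addition rule for every admissible `φ` to the reduced tensor product
`(ℛ(λλ',λ'), ψ)`. [cite: ConnesConsani2016ArithmeticSite, Prop. 7.3 (ii)] -/
theorem isTensorReduction_of_keyRule {l l' : ℝ} (hl : 0 < l) (hl' : 0 < l')
    (hK : ∀ (R : Type) [CommSemiring R] [IsCancelMulZero R] (φ : frobSemiring l → frobSemiring l' → R),
      IsBalancedBimul (frobCorrespondence l hl) (frobCorrespondence l' hl') φ → KeyRule φ) :
    IsTensorReduction (frobCorrespondence l hl) (frobCorrespondence l' hl') (frobSemiring₂ (l * l') l')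
      (frobPsi l l' hl') :=
  ⟨inferInstance, ConnesConsani2016_prop_7_3_i hl hl', fun R _ _ φ hφ =>
    existsUnique_rho hl hl' φ (hK R φ hφ) hφ⟩


/-! ## Proposition 7.3 (ii): the addition rule (60) and the universal property of `ℛ(λλ', λ')` -/

/-- "We can find `n ∈ ℕ` and `k, k' ∈ ℕ` such that `α₁ ≤ k/n`, `k'/n ≤ α₂`,
`λ'k/n + β₁ < λ'k'/n + β₂`" (multiplied through by `n`). [cite: ConnesConsani2016ArithmeticSite, Prop. 7.3 (proof of (ii))] -/
theorem exists_nat_approx {l' a₁ a₂ b₁ b₂ : ℝ} (hl' : 0 < l') (ha₁ : 0 ≤ a₁) (ha₂ : 0 ≤ a₂)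
    (h : l' * a₁ + b₁ < l' * a₂ + b₂) :
    ∃ n k k' : ℕ, 0 < n ∧ (n : ℝ) * a₁ ≤ k ∧ (k' : ℝ) ≤ n * a₂ ∧
      l' * k + n * b₁ < l' * k' + n * b₂ := by
  set g := (l' * a₂ + b₂) - (l' * a₁ + b₁) with hg
  have hg0 : 0 < g := by rw [hg]; linarith
  obtain ⟨n, hn⟩ := exists_nat_gt (2 * l' / g)
  have hn0 : (0 : ℝ) < n := lt_trans (by positivity) hn
  have hn' : 2 * l' < n * g := by rwa [div_lt_iff₀ hg0] at hn
  refine ⟨n, ⌈(n : ℝ) * a₁⌉₊, ⌊(n : ℝ) * a₂⌋₊, by exact_mod_cast hn0, Nat.le_ceil _,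
    Nat.floor_le (mul_nonneg hn0.le ha₂), ?_⟩
  have hk : (⌈(n : ℝ) * a₁⌉₊ : ℝ) < n * a₁ + 1 := Nat.ceil_lt_add_one (mul_nonneg hn0.le ha₁)
  have hk' : (n : ℝ) * a₂ < ⌊(n : ℝ) * a₂⌋₊ + 1 := Nat.lt_floor_add_one _
  have h1 : l' * (⌈(n : ℝ) * a₁⌉₊ : ℝ) < l' * (n * a₁ + 1) := mul_lt_mul_of_pos_left hk hl'
  have h2 : l' * (n * a₂ - 1) < l' * (⌊(n : ℝ) * a₂⌋₊ : ℝ) := mul_lt_mul_of_pos_left (by linarith) hl'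
  have h3 : l' * (n * a₁ + 1) + n * b₁ ≤ l' * (n * a₂ - 1) + n * b₂ := by
    rw [hg] at hn'
    nlinarith
  linarith

/-- **The addition rule (60)** of the proof of Prop. 7.3 (ii): "Let `αᵢ ∈ ℕ + λℕ`, `βᵢ ∈ ℕ + λ'ℕ` be
such that `λ'α₁ + β₁ < λ'α₂ + β₂`. Let us show that
`φ(q^{α₁}, q^{β₁}) + φ(q^{α₂}, q^{β₂}) = φ(q^{α₁}, q^{β₁})`" — for any balanced bilinear
multiplicative `φ` into a multiplicatively cancellative semiring. Proof as printed: pass to `n`-th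
powers (injectivity of `x ↦ xⁿ`), squeeze `k/n, k'/n` between, and use bilinearity with the
balance relation (62). [cite: ConnesConsani2016ArithmeticSite, Prop. 7.3 (proof of (ii), eq. (60)–(62))] -/
theorem ConnesConsani2016_prop_7_3_addRule {l l' : ℝ} (hl : 0 < l) (hl' : 0 < l') {R : Type*}
    [CommSemiring R] [IsCancelMulZero R] {φ : frobSemiring l → frobSemiring l' → R}
    (hφ : IsBalancedBimul (frobCorrespondence l hl) (frobCorrespondence l' hl') φ) {a₁ a₂ b₁ b₂ : ℝ}
    (ha₁ : a₁ ∈ frobRange l) (ha₂ : a₂ ∈ frobRange l) (hb₁ : b₁ ∈ frobRange l')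
    (hb₂ : b₂ ∈ frobRange l') (hlt : l' * a₁ + b₁ < l' * a₂ + b₂) :
    φ (rElt l a₁ ha₁) (rElt l' b₁ hb₁) + φ (rElt l a₂ ha₂) (rElt l' b₂ hb₂) =
      φ (rElt l a₁ ha₁) (rElt l' b₁ hb₁) := by
  obtain ⟨n, k, k', hn, hk, hk', hlt'⟩ :=
    exists_nat_approx hl' (frobRange_nonneg hl ha₁) (frobRange_nonneg hl ha₂) hlt
  apply add_eq_left_of_pow_charOne hφ.one_add_one hn.ne'
  rw [← hφ.pow_rElt ha₁ hb₁ n (nat_mul_mem_frobRange' ha₁ n) (nat_mul_mem_frobRange' hb₁ n),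
    ← hφ.pow_rElt ha₂ hb₂ n (nat_mul_mem_frobRange' ha₂ n) (nat_mul_mem_frobRange' hb₂ n)]
  -- the four auxiliary values
  have hKb₁ : (n : ℝ) * b₁ + k * l' ∈ frobRange l' :=
    add_mem_frobRange (nat_mul_mem_frobRange' hb₁ n) (nat_mul_mem_frobRange l' k)
  have hKb₂ : (n : ℝ) * b₂ + k' * l' ∈ frobRange l' :=
    add_mem_frobRange (nat_mul_mem_frobRange' hb₂ n) (nat_mul_mem_frobRange l' k')
  set X := φ (rElt l (n * a₁) (nat_mul_mem_frobRange' ha₁ n)) (rElt l' (n * b₁) (nat_mul_mem_frobRange' hb₁ n))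
  set Y := φ (rElt l (n * a₂) (nat_mul_mem_frobRange' ha₂ n)) (rElt l' (n * b₂) (nat_mul_mem_frobRange' hb₂ n))
  set K := φ (rElt l k (nat_mem_frobRange l k)) (rElt l' (n * b₁) (nat_mul_mem_frobRange' hb₁ n))
  set K' := φ (rElt l k' (nat_mem_frobRange l k')) (rElt l' (n * b₂) (nat_mul_mem_frobRange' hb₂ n))
  -- `X = X + K` since `nα₁ ≤ k`
  have hXK : X + K = X := hφ.add_left_le _ _ hk _
  -- `K = φ(1, q^{nβ₁ + λ'k})`, `K' = φ(1, q^{nβ₂ + λ'k'})` by (62)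
  have hK0 : K = φ (rElt l 0 (zero_mem_frobRange l)) (rElt l' (n * b₁ + k * l') hKb₁) := by
    have h := hφ.bal_rElt (zero_mem_frobRange l) (nat_mul_mem_frobRange' hb₁ n) k
      (by simpa using nat_mem_frobRange l k) hKb₁
    rwa [rElt_congr _ (nat_mem_frobRange l k) (zero_add _)] at h
  have hK'0 : K' = φ (rElt l 0 (zero_mem_frobRange l)) (rElt l' (n * b₂ + k' * l') hKb₂) := by
    have h := hφ.bal_rElt (zero_mem_frobRange l) (nat_mul_mem_frobRange' hb₂ n) k'
      (by simpa using nat_mem_frobRange l k') hKb₂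
    rwa [rElt_congr _ (nat_mem_frobRange l k') (zero_add _)] at h
  -- `K + K' = K` since `nβ₁ + λ'k < nβ₂ + λ'k'`
  have hKK' : K + K' = K := by
    rw [hK0, hK'0]
    exact hφ.add_right_le _ hKb₁ hKb₂ (by linarith)
  -- `K' = K' + Y` since `k' ≤ nα₂`
  have hK'Y : K' + Y = K' := hφ.add_left_le _ _ hk' _
  calc X + Y = X + K + Y := by rw [hXK]
    _ = X + (K + K' + Y) := by rw [hKK', add_assoc]
    _ = X + (K + (K' + Y)) := by rw [add_assoc K]
    _ = X + K := by rw [hK'Y, hKK']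
    _ = X := hXK

/-- "Every element of `ℛ(λλ', λ')` is uniquely of the form `q^z`, `z = xλλ' + β`, `x ∈ ℕ`,
`β ∈ ℕλ' + ℕ`" when `λλ' ∉ ℚλ' + ℚ`. [cite: ConnesConsani2016ArithmeticSite, Prop. 7.3 (proof of (ii))] -/
theorem frobRange₂_rep_unique {l l' : ℝ} (h : ∀ s t : ℚ, l * l' ≠ s * l' + t) {x x' : ℕ} {β β' : ℝ}
    (hβ : β ∈ frobRange l') (hβ' : β' ∈ frobRange l') (heq : x * (l * l') + β = x' * (l * l') + β') :
    x = x' ∧ β = β' := by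
  by_cases hx : x = x'
  · subst hx
    exact ⟨rfl, by linarith⟩
  · exfalso
    obtain ⟨m, k, rfl⟩ := hβ
    obtain ⟨m', k', rfl⟩ := hβ'
    have hxR : (x : ℝ) - x' ≠ 0 := by
      have : (x : ℝ) ≠ x' := by exact_mod_cast hx
      intro h0; exact this (by linarith)
    refine h (((m' : ℚ) - m) / ((x : ℚ) - x')) (((k' : ℚ) - k) / ((x : ℚ) - x')) ?_
    push_cast
    field_simp
    linear_combination heq

/-- The addition rule for `ℛ(λλ',λ')` when `λλ' ∉ ℚλ' + ℚ` ("This follows from (60) applied to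
`α₁ = xλ`, `β₁ = β`, `α₂ = x'λ`, `β₂ = β'`"). [cite: ConnesConsani2016ArithmeticSite, Prop. 7.3 (proof of (ii))] -/
theorem keyRule_of_not_mem_ratSpan {l l' : ℝ} (hl : 0 < l) (hl' : 0 < l')
    (h : ∀ s t : ℚ, l * l' ≠ s * l' + t) {R : Type} [CommSemiring R] [IsCancelMulZero R]
    (φ : frobSemiring l → frobSemiring l' → R)
    (hφ : IsBalancedBimul (frobCorrespondence l hl) (frobCorrespondence l' hl') φ) : KeyRule φ := by
  intro x β hβ x' β' hβ' hle
  rcases hle.lt_or_eq with hlt | heq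
  · exact ConnesConsani2016_prop_7_3_addRule hl hl' hφ (nat_mul_mem_frobRange l x)
      (nat_mul_mem_frobRange l x') hβ hβ' (by linarith)
  · obtain ⟨rfl, rfl⟩ := frobRange₂_rep_unique h hβ hβ' heq
    exact hφ.add_self _ _

/-- **Connes–Consani 2016, Proposition 7.3 (ii)**: "Let `R` be a semiring and
`φ : ℛ(λ) × ℛ(λ') → R` be a bilinear map such that `φ(aa', bb') = φ(a,b)φ(a',b')` […] and
`φ(r(λ)(x)a, b) = φ(a, ℓ(λ')(x)b)` […]. Then, assuming `λλ' ∉ ℚλ' + ℚ`, there exists a unique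
homomorphism `ρ : ℛ(λλ', λ') → R` such that `φ = ρ ∘ ψ`." (`R` multiplicatively cancellative, as
the printed proof uses.) [cite: ConnesConsani2016ArithmeticSite, Prop. 7.3 (ii)] -/
theorem ConnesConsani2016_prop_7_3_ii {l l' : ℝ} (hl : 0 < l) (hl' : 0 < l')
    (h : ∀ s t : ℚ, l * l' ≠ s * l' + t) {R : Type} [CommSemiring R] [IsCancelMulZero R]
    (φ : frobSemiring l → frobSemiring l' → R)
    (hφ : IsBalancedBimul (frobCorrespondence l hl) (frobCorrespondence l' hl') φ) :
    ∃! ρ : frobSemiring₂ (l * l') l' →+* R, ∀ a b, ρ (frobPsi l l' hl' a b) = φ a b :=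
  existsUnique_rho hl hl' φ (keyRule_of_not_mem_ratSpan hl hl' h φ hφ) hφ

/-- **Proposition 7.3 packaged**: for `λλ' ∉ ℚλ' + ℚ`, `(ℛ(λλ',λ'), ψ)` is the reduced semiring
of `ℛ(λ) ⊗_{ℤ_min⁺} ℛ(λ')` ("By Proposition 7.3 the reduction of `ℛ(λ) ⊗_{ℤ_min⁺} ℛ(λ')` is
`ℛ(λλ',λ')`", proof of Thm. 7.7). [cite: ConnesConsani2016ArithmeticSite, Prop. 7.3 and §7.4 (proof of Thm. 7.7)] -/
theorem ConnesConsani2016_prop_7_3 {l l' : ℝ} (hl : 0 < l) (hl' : 0 < l')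
    (h : ∀ s t : ℚ, l * l' ≠ s * l' + t) :
    IsTensorReduction (frobCorrespondence l hl) (frobCorrespondence l' hl')
      (frobSemiring₂ (l * l') l') (frobPsi l l' hl') :=
  isTensorReduction_of_keyRule hl hl' fun _ _ _ φ hφ => keyRule_of_not_mem_ratSpan hl hl' h φ hφ

/-! ### Rational `λ` (the case "λ and λ' rational" of Thm. 7.7, stated in print without proof)

For `λ = a/b ∈ ℚ₊*` the relation `q^{bλ} = q^a` makes every value of `φ` a `b`-th root of a
value `φ(1, q^γ)`, `γ ∈ ℕλ' + ℕ`, on which additivity is that of `φ(1, ·)`; with the injectivity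
of `x ↦ x^b` this gives the addition rule directly (no diophantine approximation and no
hypothesis on `λ'`). This argument is ours; the source only asserts the conclusion. -/

/-- A positive rational real is `a/b` with `a, b ∈ ℕ`, `b > 0`. [folklore] -/
private theorem exists_nat_div_of_rat {l : ℝ} (hl : 0 < l) (hq : ∃ q : ℚ, (q : ℝ) = l) :
    ∃ a b : ℕ, 0 < b ∧ (b : ℝ) * l = a := by
  obtain ⟨q, rfl⟩ := hq
  have hq0 : 0 < q := by exact_mod_cast hl
  refine ⟨q.num.toNat, q.den, q.den_pos, ?_⟩
  have hnum : ((q.num.toNat : ℕ) : ℤ) = q.num := Int.toNat_of_nonneg (Rat.num_pos.2 hq0).le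
  have h1 : (q : ℝ) = (q.num : ℝ) / (q.den : ℝ) := by rw [Rat.cast_def]
  have h2 : (q.num : ℝ) = ((q.num.toNat : ℕ) : ℝ) := by exact_mod_cast hnum.symm
  rw [h1, h2]
  field_simp

/-- The addition rule for `ℛ(λλ',λ')` when `λ ∈ ℚ` (any `λ' > 0`) — our proof of the step
behind "The same equality holds if `λ` and `λ'` are rational" (stated without proof in the source).
[cite: ConnesConsani2016ArithmeticSite, Thm. 7.7 (second sentence)] -/
theorem keyRule_of_rat {l l' : ℝ} (hl : 0 < l) (hl' : 0 < l') (hq : ∃ q : ℚ, (q : ℝ) = l)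
    {R : Type} [CommSemiring R] [IsCancelMulZero R] (φ : frobSemiring l → frobSemiring l' → R)
    (hφ : IsBalancedBimul (frobCorrespondence l hl) (frobCorrespondence l' hl') φ) : KeyRule φ := by
  obtain ⟨a, b, hb, hbl⟩ := exists_nat_div_of_rat hl hq
  intro x β hβ x' β' hβ' hle
  apply add_eq_left_of_pow_charOne hφ.one_add_one hb.ne'
  -- `Φ(x,β)^b = φ(1, q^{bβ + xaλ'})`
  have hpow : ∀ (y : ℕ) (γ : ℝ) (hγ : γ ∈ frobRange l') (h' : (b : ℝ) * γ + (y * a : ℕ) * l' ∈ frobRange l'),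
      Phi φ y γ hγ ^ b = φ (rElt l 0 (zero_mem_frobRange l)) (rElt l' (b * γ + (y * a : ℕ) * l') h') := by
    intro y γ hγ h'
    unfold Phi
    rw [← hφ.pow_rElt (nat_mul_mem_frobRange l y) hγ b (nat_mul_mem_frobRange' (nat_mul_mem_frobRange l y) b)
      (nat_mul_mem_frobRange' hγ b)]
    have e := hφ.bal_rElt (zero_mem_frobRange l) (nat_mul_mem_frobRange' hγ b) (y * a)
      (by simpa using nat_mem_frobRange l (y * a)) h'
    rw [rElt_congr _ (nat_mul_mem_frobRange' (nat_mul_mem_frobRange l y) b)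
      (by push_cast; rw [← hbl]; ring)] at e
    exact e
  have h1 : (b : ℝ) * β + (x * a : ℕ) * l' ∈ frobRange l' :=
    add_mem_frobRange (nat_mul_mem_frobRange' hβ b) (nat_mul_mem_frobRange l' (x * a))
  have h2 : (b : ℝ) * β' + (x' * a : ℕ) * l' ∈ frobRange l' :=
    add_mem_frobRange (nat_mul_mem_frobRange' hβ' b) (nat_mul_mem_frobRange l' (x' * a))
  rw [hpow x β hβ h1, hpow x' β' hβ' h2]
  refine hφ.add_right_le _ h1 h2 ?_
  have := mul_le_mul_of_nonneg_left hle (Nat.cast_nonneg b : (0 : ℝ) ≤ b)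
  push_cast
  rw [← hbl] at *
  nlinarith [this]

/-- `(ℛ(λλ',λ'), ψ)` is the reduced semiring of `ℛ(λ) ⊗ ℛ(λ')` also when `λ ∈ ℚ` (our proof
of the reduction step for the printed rational case of Thm. 7.7). [cite: ConnesConsani2016ArithmeticSite, Thm. 7.7 (second sentence)] -/
theorem isTensorReduction_of_rat {l l' : ℝ} (hl : 0 < l) (hl' : 0 < l') (hq : ∃ q : ℚ, (q : ℝ) = l) :
    IsTensorReduction (frobCorrespondence l hl) (frobCorrespondence l' hl')
      (frobSemiring₂ (l * l') l') (frobPsi l l' hl') :=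
  isTensorReduction_of_keyRule hl hl' fun _ _ _ φ hφ => keyRule_of_rat hl hl' hq φ hφ

/-! ## Theorem 7.7: `Ψ(λ) ∘ Ψ(λ') = Ψ(λλ')` -/

/-- The inclusion of sub-semirings is the identity on underlying elements. [folklore] -/
private theorem coe_subsemiringInclusion {S T : Subsemiring 𝕋} (h : S ≤ T) (x : S) :
    (Subsemiring.inclusion h x : 𝕋) = x := rfl

/-- The composition datum of Thm. 7.7: once `(ℛ(λλ',λ'), ψ)` is the reduced semiring of
`ℛ(λ) ⊗ ℛ(λ')`, "the sub-semiring of the reduction of `ℛ(λ) ⊗_{ℤ_min⁺} ℛ(λ')` which is generated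
by `ℓ(ℤ_min⁺)` and `r(ℤ_min⁺)` is `ℛ(λλ')` and the left and right actions of `ℤ_min⁺` are the same
as for the correspondence `Ψ(λλ')`": `ℓ(q^n) q^α = q^{λλ'n} q^α`, `r(q^n) q^α = q^{n+α}`.
[cite: ConnesConsani2016ArithmeticSite, Thm. 7.7 (proof, first paragraph of §7.4)] -/
def frobCompositionDatum {l l' : ℝ} (hl : 0 < l) (hl' : 0 < l')
    (hT : IsTensorReduction (frobCorrespondence l hl) (frobCorrespondence l' hl')
      (frobSemiring₂ (l * l') l') (frobPsi l l' hl')) :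
    CompositionDatum (frobCorrespondence l hl) (frobCorrespondence l' hl')
      (frobCorrespondence (l * l') (mul_pos hl hl')) where
  T := frobSemiring₂ (l * l') l'
  ψ := frobPsi l l' hl'
  isTensorReduction := hT
  emb := Subsemiring.inclusion (frobSemiring_le_frobSemiring₂ l l')
  emb_injective := Subsemiring.inclusion_injective _
  emb_ell x := Subtype.ext (by
    rcases eq_zero_or_eq_nexp x with rfl | ⟨n, rfl⟩
    · rw [map_zero, map_zero, coe_frobPsi, Subsemiring.coe_zero, coe_frobEll_zero, map_zero, zero_mul]
    · rw [coe_subsemiringInclusion, coe_frobPsi, coe_frobEll_nexp, coe_frobEll_nexp, frob_texp,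
        Subsemiring.coe_one, mul_one, texp_inj]
      ring)
  emb_r x := Subtype.ext (by
    rcases eq_zero_or_eq_nexp x with rfl | ⟨n, rfl⟩
    · rw [map_zero, map_zero, coe_frobPsi, Subsemiring.coe_zero, coe_frobR_zero, mul_zero]
    · rw [coe_subsemiringInclusion, coe_frobPsi, coe_frobR_nexp, coe_frobR_nexp, Subsemiring.coe_one,
        map_one, one_mul])

/-- **Connes–Consani 2016, Theorem 7.7 (= Thm. 1.2 = CRAS 2014 Thm. 4.1), the case
`λλ' ∉ ℚλ' + ℚ`** (which contains every case `λλ' ∉ ℚ` with `λ' ∈ ℚ`): "Let `λ, λ' ∈ ℝ₊*` such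
that `λλ' ∉ ℚ`. The composition of the Frobenius correspondences is then given by
`Ψ(λ) ∘ Ψ(λ') = Ψ(λλ')`." — here under the hypothesis of Prop. 7.3, through which the printed
proof goes in this case; the remaining sub-case of `λλ' ∉ ℚ` (`λ ∉ ℚ`, `λλ' ∈ ℚλ' + ℚ`) goes
through the germ semiring `ℛ_ε(λλ',λ')` of Prop. 7.4 and is not typed in this file.
[cite: ConnesConsani2016ArithmeticSite, Thm. 7.7] -/
theorem ConnesConsani2016_thm_7_7_generic {l l' : ℝ} (hl : 0 < l) (hl' : 0 < l')
    (h : ∀ s t : ℚ, l * l' ≠ s * l' + t) :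
    IsComposition (frobCorrespondence l hl) (frobCorrespondence l' hl')
      (frobCorrespondence (l * l') (mul_pos hl hl')) :=
  ⟨frobCompositionDatum hl hl' (ConnesConsani2016_prop_7_3 hl hl' h)⟩

/-- **Theorem 7.7 for `λ ∈ ℚ₊*` (any `λ'`)**: `Ψ(λ) ∘ Ψ(λ') = Ψ(λλ')` — contains the printed
"The same equality holds if `λ` and `λ'` are rational" and the case `λ ∈ ℚ`, `λ' ∉ ℚ` of the
first sentence. Proof: `isTensorReduction_of_rat` (ours; the source gives no proof for rational
`λ`). [cite: ConnesConsani2016ArithmeticSite, Thm. 7.7] -/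
theorem ConnesConsani2016_thm_7_7_of_rat_left {l l' : ℝ} (hl : 0 < l) (hl' : 0 < l')
    (hq : ∃ q : ℚ, (q : ℝ) = l) :
    IsComposition (frobCorrespondence l hl) (frobCorrespondence l' hl')
      (frobCorrespondence (l * l') (mul_pos hl hl')) :=
  ⟨frobCompositionDatum hl hl' (isTensorReduction_of_rat hl hl' hq)⟩

/-- **Connes–Consani 2016, Theorem 7.7, second sentence**: "The same equality
[`Ψ(λ) ∘ Ψ(λ') = Ψ(λλ')`] holds if `λ` and `λ'` are rational."
[cite: ConnesConsani2016ArithmeticSite, Thm. 7.7] -/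
theorem ConnesConsani2016_thm_7_7_rat {l l' : ℝ} (hl : 0 < l) (hl' : 0 < l')
    (hq : ∃ q : ℚ, (q : ℝ) = l) (_hq' : ∃ q' : ℚ, (q' : ℝ) = l') :
    IsComposition (frobCorrespondence l hl) (frobCorrespondence l' hl')
      (frobCorrespondence (l * l') (mul_pos hl hl')) :=
  ConnesConsani2016_thm_7_7_of_rat_left hl hl' hq

/-- **Theorem 7.7, first sentence, when `λ' ∈ ℚ₊*`**: `λλ' ∉ ℚ` and `λ' ∈ ℚ` give
`λλ' ∉ ℚλ' + ℚ = ℚ`, so `Ψ(λ) ∘ Ψ(λ') = Ψ(λλ')` by the generic case.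
[cite: ConnesConsani2016ArithmeticSite, Thm. 7.7] -/
theorem ConnesConsani2016_thm_7_7_of_rat_right {l l' : ℝ} (hl : 0 < l) (hl' : 0 < l')
    (hq' : ∃ q' : ℚ, (q' : ℝ) = l') (hirr : Irrational (l * l')) :
    IsComposition (frobCorrespondence l hl) (frobCorrespondence l' hl')
      (frobCorrespondence (l * l') (mul_pos hl hl')) := by
  refine ConnesConsani2016_thm_7_7_generic hl hl' fun s t h => ?_
  obtain ⟨q', rfl⟩ := hq'
  exact hirr ⟨s * q' + t, by push_cast; exact h.symm⟩


end Literature.NumberTheory.ConnesConsani
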